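import Literature.MathematicalPhysics.QuantumManyBody.BogoliubovWeylCalculus
import Mathlib.RingTheory.MvPolynomial.WeightedHomogeneous
import HarnessLib

/-!
# The cubic trial vector as a sum over admissible sets of triples:
# `ξ = ∑_{S admissible} (∏_{τ∈S} κ_τ) X^{d(S)}`, its norm, particle number and kinetic energy

Topic `Literature/MathematicalPhysics/QuantumManyBody`, namespace `BoseGas.Fock`; the vector
`ξ_ν = e^{A_ν}Ω` of [BastiCenatiempoSchlein2021, (2.12)–(2.13)] for the provefact
`Literature.MathematicalPhysics.QuantumManyBody.BoseGas.BastiCenatiempoSchlein2021_upperBound`,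
in the holomorphic Fock model `MvPolynomial ι ℂ` (`TorusBoseFockLayer.lean`).

By [ibid., (2.13) = (eq:AmO)] `A_ν^mΩ = N^{-m/2} ∑ ∏ᵢ η_{rᵢ}σ_{vᵢ} θ({r_j,v_j}) a†_{r_m+v_m}a†_{-r_m}a†_{-v_m}⋯Ω`,
where the cutoff `θ` forces the `m` triples of momenta `(r+v, -r, -v)` to be non-interfering; the
`m!` orderings of the same set of triples give the same vector, so
`ξ_ν = ∑_m A_ν^mΩ/m! = ∑_{S admissible set of triples} (∏_{τ∈S} κ_τ) ∏_{τ∈S} a†_{u_τ}a†_{a_τ}a†_{b_τ}Ω`.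
This file takes that **set form as the definition** (`Fock.setVector`), for an abstract finite type
`T` of triples with slots `u, a, b : T → ι` (`u = r+v`, `a = -r`, `b = -v`), amplitudes
`κ : T → ℂ` and a decidable admissibility predicate `Adm` on `Finset T`, and proves the exact
formulas that replace [ibid., (2.14)–(2.16) = (normA)] and [ibid., Prop. 2.3, (5.2)–(5.4)]:

* `fockInner_setVector_self`: if admissible sets have pairwise distinct occupation vectors
  (`Adm S → Adm S' → d(S) = d(S') → S = S'`, the "unique pairing" consequence of the cutoffs,
  [ibid., after (2.15)]) then `‖ξ‖² = ∑_{S adm} d(S)! |∏κ|²`, and `= ∑_{S adm} ∏|κ_τ|²` when the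
  `d(S)` are squarefree (`fockInner_setVector_self_of_squarefree`) — this is (normA);
* `sum_mul_fockInner_pderiv_setVector`: for any weight `w` (kinetic energy `w = ε`, number `w = 1`),
  `∑_p w_p‖a_pξ‖² = ∑_{S adm} |∏κ|² ∑_{τ∈S}(w_{u_τ} + w_{a_τ} + w_{b_τ})` (squarefree case) — the
  exact form of `⟨ξ_ν, 𝒦ξ_ν⟩` [ibid., (5.2)] and `⟨ξ_ν, 𝒩ξ_ν⟩ = ∑ 3|S| |c_S|²`;
* `sum_mul_fockInner_pderiv_setVector_le`: for a **hereditary** `Adm` and `w ≥ 0`,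
  `∑_p w_p‖a_pξ‖² ≤ (∑_τ (w_{u_τ}+w_{a_τ}+w_{b_τ})|κ_τ|²) ‖ξ‖²` — the bound (5.3) = (eq:K)
  ("replacing `θ({r_j,v_j}_{j=1}^m)` with `θ({r_j,v_j}_{j=1}^{m-1})`"), whence
  `⟨ξ,𝒩ξ⟩ ≤ 3(∑|κ|²)‖ξ‖²` (Prop. 2.3 for `j = 1` in this exact form).

* gradings and support (`isWeightedHomogeneous_setVector`, `pderiv_setVector_eq_zero`): `ξ` is
  weighted-homogeneous of weight `0` for every additive weight vanishing on all triples (total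
  momentum; the `P_H/P_S` count `1,1,-2`; `1 ∈ ℤ/3ℤ`), and `a_pξ = 0` off the occupied modes.

**The momentum instance** (`Triple`, `TripleAdm`, `cubicVector`): `T` = oriented triples `(u,a,b)`
of modes with `u, a ∈ P_H`, `b ∈ P_S`, `e u + e a + e b = 0`, `u < a`; `Adm = θ` of [ibid., (2.13)]
(`e pᵢ + e pₖ + e bⱼ ≠ 0` for `τⱼ ≠ τₖ`, `pᵢ ∈ {uᵢ,aᵢ}`, `pₖ ∈ {uₖ,aₖ}`), hereditary
(`TripleAdm.mono`); for `P_H ∩ P_S = ∅` admissible sets have squarefree occupations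
(`TripleAdm.setOcc_le_one`) and **unique pairing** holds (`TripleAdm.eq_of_setOcc_eq`, the argument
of [ibid., after (2.15)]), so all the above applies to `cubicVector e PH PS κ`
(`fockInner_cubicVector_self`, `sum_mul_fockInner_pderiv_cubicVector(_le)`,
`pderiv_cubicVector_eq_zero`, `isWeightedHomogeneous_cubicVector(_momentum)`).

**Contractions and freeing** (appended): the generalized hereditary bound with a set weight `G`
(`sum_normSq_setCoeff_mul_sum_mul_le`) and the second-moment bound
`∑|c_S|²|S|(|S|-1) ≤ (∑|κ|²)²∑|c_S|²` [ibid., (5.4)]; the **triple contraction**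
`⟨ξ_ν, a†_ua†_aa†_bξ_ν⟩ = conj κ_τ ∑_{θ(S), τ∈S} |c_{S∖τ}|²` (`fockInner_cubicVector_X_mul_X_mul_X_mul`:
creating a triple on an admissible set only pairs with the set enlarged by that triple,
`TripleAdm.mem_of_setOcc_eq_add`), and its **freed form** `= conj κ_τ (‖ξ_ν‖² - D_τ)` with the
cutoff defect `D_τ = ∑_{θ(S), τ∈S ∨ ¬θ(S∪τ)} |c_S|²` (`sum_ite_adm_mem_normSq_erase`,
`sum_mul_fockInner_cubicVector_create` = the split `⟨ξ_ν,𝒞_Nξ_ν⟩ = I_𝒞 + J_𝒞` of [ibid., §5.2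
(5.8)–(5.10)], `sum_norm_mul_defect_eq`).

**Quartic pairing structure** (appended): for hard modes `x ≠ y`, `x' ≠ y'` and admissible `S, S'`
with `d(S) + δ_{x'} + δ_{y'} = d(S') + δ_x + δ_y`, a triple of `S ∖ S'` is pinned to `x` or `y`
(`TripleAdm.pinned_of_setOcc_eq`, via `TripleAdm.mem_of_slots_occupied`) and `|S ∖ S'| ≤ 2`
(`TripleAdm.card_sdiff_le_two`) — "at most two indices can be involved in contractions with the
observable" [ibid., §5.3, cases 1)–2)]; and, in the generic layer, the two-annihilation pairing
formula `fockInner_pderiv_pderiv_setVector` (`⟨a_ya_xξ, a_{y'}a_{x'}ξ⟩` as the indicator sum over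
pairs `(S, S')` with `x, y` occupied in `S`, `x', y'` in `S'`, `d(S) + δ_{x'} + δ_{y'} = d(S') + δ_x + δ_y`).

## References

* [BastiCenatiempoSchlein2021] G. Basti, S. Cenatiempo, B. Schlein, Forum Math. Sigma 9 (2021) e74,
  arXiv:2101.06222: (2.12)–(2.16), Prop. 2.3, §5.1 (5.2)–(5.4), §5.2 (5.8)–(5.11), §5.3.
-/

noncomputable section

namespace Literature.MathematicalPhysics.QuantumManyBody.BoseGas

open Complex MvPolynomial Finset
open scoped ComplexConjugate BigOperators

namespace Fock

variable {ι : Type*} [DecidableEq ι] {T : Type*} [Fintype T]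

/-! ### Occupation vectors of triples and of sets of triples; the set vector -/

/-- The occupation vector `δ_u + δ_a + δ_b` of the triple `τ` (modes `u_τ = r+v`, `a_τ = -r`,
`b_τ = -v`). [cite: BastiCenatiempoSchlein2021, (2.12)] -/
def tripleOcc (u a b : T → ι) (τ : T) : ι →₀ ℕ :=
  Finsupp.single (u τ) 1 + Finsupp.single (a τ) 1 + Finsupp.single (b τ) 1

/-- The occupation vector `d(S) = ∑_{τ∈S} (δ_{u_τ} + δ_{a_τ} + δ_{b_τ})` of a set of triples.
[cite: BastiCenatiempoSchlein2021, (2.13)] -/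
def setOcc (u a b : T → ι) (S : Finset T) : ι →₀ ℕ := ∑ τ ∈ S, tripleOcc u a b τ

/-- The coefficient `c_S = [S admissible] ∏_{τ∈S} κ_τ`. [cite: BastiCenatiempoSchlein2021, (2.13)] -/
def setCoeff (κ : T → ℂ) (Adm : Finset T → Prop) [DecidablePred Adm] (S : Finset T) : ℂ :=
  if Adm S then ∏ τ ∈ S, κ τ else 0

/-- **The set vector** `ξ = ∑_{S admissible} (∏_{τ∈S} κ_τ) X^{d(S)}` — the cubic trial vector
`ξ_ν = e^{A_ν}Ω = ∑_m A_ν^mΩ/m!` of [ibid.] written as a sum over admissible sets of triples.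
[cite: BastiCenatiempoSchlein2021, (2.12)–(2.13)] -/
def setVector (u a b : T → ι) (κ : T → ℂ) (Adm : Finset T → Prop) [DecidablePred Adm] :
    MvPolynomial ι ℂ :=
  ∑ S : Finset T, monomial (setOcc u a b S) (setCoeff κ Adm S)

section Basic

variable {u a b : T → ι} {κ : T → ℂ} {Adm : Finset T → Prop} [DecidablePred Adm]

omit [DecidableEq ι] [Fintype T] in
/-- Non-admissible sets carry coefficient `0`. [folklore] -/
theorem setCoeff_of_not {S : Finset T} (h : ¬ Adm S) : setCoeff κ Adm S = 0 := if_neg h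

omit [DecidableEq ι] [Fintype T] in
/-- Admissible sets carry the product of the amplitudes. [folklore] -/
theorem setCoeff_of {S : Finset T} (h : Adm S) : setCoeff κ Adm S = ∏ τ ∈ S, κ τ := if_pos h

omit [DecidableEq ι] [Fintype T] in
/-- The coefficient factorises over the removal of one triple (hereditary use). [folklore] -/
theorem prod_eq_mul_prod_erase [DecidableEq T] {S : Finset T} {τ : T} (hτ : τ ∈ S) :
    ∏ τ' ∈ S, κ τ' = κ τ * ∏ τ' ∈ S.erase τ, κ τ' := (Finset.mul_prod_erase S κ hτ).symm

omit [DecidableEq ι] [Fintype T] in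
/-- The degree of `d(S)` is `3|S|`. [folklore] -/
theorem degree_setOcc (S : Finset T) : (setOcc u a b S).degree = 3 * S.card := by
  unfold setOcc tripleOcc
  rw [map_sum, Finset.card_eq_sum_ones, Finset.mul_sum]
  refine Finset.sum_congr rfl fun τ _ => ?_
  simp only [map_add, Finsupp.degree_single, mul_one]

omit [DecidableEq ι] [Fintype T] in
/-- Linear weights of `d(S)`: `∑_p w_p d(S)_p = ∑_{τ∈S} (w_{u_τ} + w_{a_τ} + w_{b_τ})`. [folklore] -/
theorem weight_setOcc (w : ι → ℝ) (S : Finset T) :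
    Finsupp.weight w (setOcc u a b S) = ∑ τ ∈ S, (w (u τ) + w (a τ) + w (b τ)) := by
  unfold setOcc tripleOcc
  rw [map_sum]
  refine Finset.sum_congr rfl fun τ _ => ?_
  simp only [map_add, Finsupp.weight_single, one_smul]

end Basic

/-! ### The norm `‖ξ‖²` (normA) -/

section Norm

variable {u a b : T → ι} {κ : T → ℂ} {Adm : Finset T → Prop} [DecidablePred Adm]

/-- Orthogonality bookkeeping: against a fixed admissible-or-not `S`, only `S' = S` contributes.
[cite: BastiCenatiempoSchlein2021, after (2.15) ("the pairing of the momenta is unique")] -/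
theorem sum_ite_setOcc_eq (hinj : ∀ S S', Adm S → Adm S' → setOcc u a b S = setOcc u a b S' → S = S')
    (S : Finset T) (F : Finset T → ℂ) :
    ∑ S' : Finset T, (if setOcc u a b S = setOcc u a b S' then
        conj (setCoeff κ Adm S) * (setCoeff κ Adm S' * F S') else 0) =
      conj (setCoeff κ Adm S) * (setCoeff κ Adm S * F S) := by
  rw [Finset.sum_eq_single S]
  · rw [if_pos rfl]
  · intro S' _ hS'
    by_cases hA' : Adm S'
    · by_cases hA : Adm S
      · rw [if_neg]
        exact fun h => hS' (hinj S S' hA hA' h).symm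
      · rw [setCoeff_of_not hA, map_zero, zero_mul, ite_self]
    · rw [setCoeff_of_not hA', zero_mul, mul_zero, ite_self]
  · exact fun h => absurd (Finset.mem_univ S) h

/-- **`‖ξ‖² = ∑_S d(S)! |c_S|²`** when admissible sets have distinct occupation vectors.
[cite: BastiCenatiempoSchlein2021, (2.14)–(2.16)] -/
theorem fockInner_setVector_self
    (hinj : ∀ S S', Adm S → Adm S' → setOcc u a b S = setOcc u a b S' → S = S') :
    fockInner (setVector u a b κ Adm) (setVector u a b κ Adm) =
      ∑ S : Finset T, (occFactorial (setOcc u a b S) : ℂ) *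
        (conj (setCoeff κ Adm S) * setCoeff κ Adm S) := by
  unfold setVector
  rw [fockInner_sum_left]
  refine Finset.sum_congr rfl fun S _ => ?_
  rw [fockInner_sum_right]
  simp only [fockInner_monomial]
  have h := sum_ite_setOcc_eq (κ := κ) hinj S (fun S' => (occFactorial (setOcc u a b S') : ℂ))
  have hfun : ∀ S' : Finset T, (if setOcc u a b S = setOcc u a b S' then
      (occFactorial (setOcc u a b S) : ℂ) * (conj (setCoeff κ Adm S) * setCoeff κ Adm S') else 0) =
      (if setOcc u a b S = setOcc u a b S' then
        conj (setCoeff κ Adm S) * (setCoeff κ Adm S' * (occFactorial (setOcc u a b S') : ℂ)) else 0) := by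
    intro S'
    split_ifs with hS
    · rw [hS]; ring
    · rfl
  simp only [hfun, h]
  ring

/-- **(normA)** `‖ξ‖² = ∑_{S} |c_S|² = ∑_{S adm} ∏_{τ∈S}|κ_τ|²` when moreover the admissible
occupation vectors are squarefree (all `3|S|` modes distinct).
[cite: BastiCenatiempoSchlein2021, (2.16)] -/
theorem fockInner_setVector_self_of_squarefree
    (hinj : ∀ S S', Adm S → Adm S' → setOcc u a b S = setOcc u a b S' → S = S')
    (hsq : ∀ S, Adm S → occFactorial (setOcc u a b S) = 1) :
    fockInner (setVector u a b κ Adm) (setVector u a b κ Adm) =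
      ∑ S : Finset T, conj (setCoeff κ Adm S) * setCoeff κ Adm S := by
  rw [fockInner_setVector_self hinj]
  refine Finset.sum_congr rfl fun S _ => ?_
  by_cases hA : Adm S
  · rw [hsq S hA, Nat.cast_one, one_mul]
  · rw [setCoeff_of_not hA, map_zero, zero_mul, mul_zero]

end Norm

/-! ### Annihilation: `∑_p w_p ‖a_pξ‖²` (kinetic energy and particle number) -/

section Annihilation

variable {u a b : T → ι} {κ : T → ℂ} {Adm : Finset T → Prop} [DecidablePred Adm]

omit [DecidableEq ι] [Fintype T] in
/-- A squarefree occupation vector has `d! = 1`. [folklore] -/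
theorem occFactorial_eq_one_of_le_one {d : ι →₀ ℕ} (hd : ∀ i, d i ≤ 1) : occFactorial d = 1 := by
  rw [occFactorial_eq_prod_of_subset d subset_rfl]
  refine Finset.prod_eq_one fun i _ => ?_
  have := hd i
  interval_cases (d i) <;> rfl

omit [DecidableEq ι] [Fintype T] in
/-- Removing one quantum from a squarefree occupation vector keeps it squarefree. [folklore] -/
theorem tsub_single_le_one {d : ι →₀ ℕ} (hd : ∀ i, d i ≤ 1) (p i : ι) :
    (d - Finsupp.single p 1 : ι →₀ ℕ) i ≤ 1 := by
  rw [Finsupp.tsub_apply]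
  exact (Nat.sub_le _ _).trans (hd i)

omit [DecidableEq ι] [Fintype T] in
/-- `d - δ_p = d' - δ_p` with `d_p, d'_p ≥ 1` forces `d = d'`. [folklore] -/
theorem eq_of_tsub_single_eq {d d' : ι →₀ ℕ} {p : ι} (hp : 1 ≤ d p) (hp' : 1 ≤ d' p)
    (h : d - Finsupp.single p 1 = d' - Finsupp.single p 1) : d = d' := by
  have h1 : d - Finsupp.single p 1 + Finsupp.single p 1 = d :=
    tsub_add_cancel_of_le (Finsupp.single_le_iff.2 hp)
  have h2 : d' - Finsupp.single p 1 + Finsupp.single p 1 = d' :=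
    tsub_add_cancel_of_le (Finsupp.single_le_iff.2 hp')
  rw [← h1, h, h2]

omit [DecidableEq ι] in
/-- `a_pξ` in the monomial basis. [cite: LSSY2005, App. A (`a(f)`, (A.13))] -/
theorem pderiv_setVector (p : ι) :
    pderiv p (setVector u a b κ Adm) =
      ∑ S : Finset T, monomial (setOcc u a b S - Finsupp.single p 1)
        (setCoeff κ Adm S * (setOcc u a b S p : ℂ)) := by
  unfold setVector
  rw [map_sum]
  refine Finset.sum_congr rfl fun S _ => ?_
  rw [pderiv_monomial]

/-- **`‖a_pξ‖² = ∑_S (d(S)-δ_p)! d(S)_p² |c_S|²`**: distinct admissible sets stay orthogonal after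
removing one quantum at `p`. [cite: BastiCenatiempoSchlein2021, §5.1 (5.2)] -/
theorem fockInner_pderiv_setVector_self
    (hinj : ∀ S S', Adm S → Adm S' → setOcc u a b S = setOcc u a b S' → S = S') (p : ι) :
    fockInner (pderiv p (setVector u a b κ Adm)) (pderiv p (setVector u a b κ Adm)) =
      ∑ S : Finset T, (occFactorial (setOcc u a b S - Finsupp.single p 1) : ℂ) *
        (conj (setCoeff κ Adm S) * setCoeff κ Adm S) * ((setOcc u a b S p : ℂ) ^ 2) := by
  rw [pderiv_setVector, fockInner_sum_left]
  refine Finset.sum_congr rfl fun S _ => ?_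
  rw [fockInner_sum_right]
  simp only [fockInner_monomial]
  rw [Finset.sum_eq_single S]
  · rw [if_pos rfl, map_mul, Complex.conj_natCast]
    ring
  · intro S' _ hS'
    by_cases hp : setOcc u a b S p = 0
    · rw [hp, Nat.cast_zero, mul_zero, map_zero, zero_mul, mul_zero, ite_self]
    by_cases hp' : setOcc u a b S' p = 0
    · rw [hp', Nat.cast_zero, mul_zero, mul_zero, mul_zero, ite_self]
    by_cases hA : Adm S
    · by_cases hA' : Adm S'
      · rw [if_neg]
        intro h
        exact hS' (hinj S S' hA hA' (eq_of_tsub_single_eq (Nat.one_le_iff_ne_zero.2 hp)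
          (Nat.one_le_iff_ne_zero.2 hp') h)).symm
      · rw [setCoeff_of_not hA', zero_mul, mul_zero, mul_zero, ite_self]
    · rw [setCoeff_of_not hA, zero_mul, map_zero, zero_mul, mul_zero, ite_self]
  · exact fun h => absurd (Finset.mem_univ S) h

/-- **The weighted annihilation identity** (squarefree admissible occupation vectors):
`∑_p w_p‖a_pξ‖² = ∑_S |c_S|² ∑_{τ∈S} (w_{u_τ} + w_{a_τ} + w_{b_τ})` — for `w = |p|²` the kinetic
energy `⟨ξ_ν, 𝒦ξ_ν⟩` [ibid., (5.2)], for `w = 1` the particle number `⟨ξ_ν, 𝒩ξ_ν⟩ = ∑ 3|S||c_S|²`.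
[cite: BastiCenatiempoSchlein2021, §5.1 (5.2)] -/
theorem sum_mul_fockInner_pderiv_setVector [Fintype ι]
    (hinj : ∀ S S', Adm S → Adm S' → setOcc u a b S = setOcc u a b S' → S = S')
    (hsq : ∀ S, Adm S → ∀ i, setOcc u a b S i ≤ 1) (w : ι → ℝ) :
    ∑ p, w p * (fockInner (pderiv p (setVector u a b κ Adm)) (pderiv p (setVector u a b κ Adm))).re =
      ∑ S : Finset T, ‖setCoeff κ Adm S‖ ^ 2 * ∑ τ ∈ S, (w (u τ) + w (a τ) + w (b τ)) := by
  -- diagonalise each `‖a_pξ‖²` and simplify the squarefree factors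
  have hdiag : ∀ p, (fockInner (pderiv p (setVector u a b κ Adm)) (pderiv p (setVector u a b κ Adm))).re =
      ∑ S : Finset T, ‖setCoeff κ Adm S‖ ^ 2 * (setOcc u a b S p : ℝ) := by
    intro p
    rw [fockInner_pderiv_setVector_self hinj, Complex.re_sum]
    refine Finset.sum_congr rfl fun S _ => ?_
    by_cases hA : Adm S
    · have h1 : occFactorial (setOcc u a b S - Finsupp.single p 1) = 1 :=
        occFactorial_eq_one_of_le_one (tsub_single_le_one (hsq S hA) p)
      have h2 : ((setOcc u a b S p : ℂ)) ^ 2 = (setOcc u a b S p : ℂ) := by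
        have := hsq S hA p
        interval_cases (setOcc u a b S p) <;> norm_num
      rw [h1, h2, Nat.cast_one, one_mul, Complex.conj_mul', ← Complex.ofReal_pow,
        ← Complex.ofReal_natCast, ← Complex.ofReal_mul, Complex.ofReal_re]
    · rw [setCoeff_of_not hA]
      simp
  simp only [hdiag, Finset.mul_sum]
  rw [Finset.sum_comm]
  refine Finset.sum_congr rfl fun S _ => ?_
  have hw := weight_setOcc (u := u) (a := a) (b := b) w S
  rw [Finsupp.weight_apply, Finsupp.sum_fintype _ _ (fun i => by simp)] at hw
  simp only [nsmul_eq_mul] at hw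
  rw [← Finset.mul_sum, ← hw, Finset.mul_sum]
  refine Finset.sum_congr rfl fun p _ => ?_
  ring

end Annihilation

/-! ### The hereditary bounds (freeing the last triple) -/

section Hereditary

variable [DecidableEq T] {u a b : T → ι} {κ : T → ℂ} {Adm : Finset T → Prop} [DecidablePred Adm]

omit [DecidableEq ι] [Fintype T] in
/-- Removing a triple from an admissible set: `|c_S|² = |κ_τ|² |c_{S∖τ}|²` (`Adm` hereditary).
[cite: BastiCenatiempoSchlein2021, §5.1 ("replacing `θ({r_j,v_j}_{j=1}^m)` with `θ({r_j,v_j}_{j=1}^{m-1})`")] -/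
theorem normSq_setCoeff_eq_of_mem (hher : ∀ S, Adm S → ∀ τ ∈ S, Adm (S.erase τ)) {S : Finset T}
    (hS : Adm S) {τ : T} (hτ : τ ∈ S) :
    ‖setCoeff κ Adm S‖ ^ 2 = ‖κ τ‖ ^ 2 * ‖setCoeff κ Adm (S.erase τ)‖ ^ 2 := by
  rw [setCoeff_of hS, setCoeff_of (hher S hS τ hτ), prod_eq_mul_prod_erase hτ, norm_mul, mul_pow]

omit [DecidableEq ι] in
/-- Reindexing `S ↦ S ∖ τ` between the sets containing `τ` and those avoiding it. [folklore] -/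
theorem sum_filter_mem_erase (τ : T) (g : Finset T → ℝ) :
    ∑ S ∈ Finset.univ.filter (fun S : Finset T => τ ∈ S), g (S.erase τ) =
      ∑ S ∈ Finset.univ.filter (fun S : Finset T => τ ∉ S), g S := by
  refine Finset.sum_bij' (fun S _ => S.erase τ) (fun S _ => insert τ S) ?_ ?_ ?_ ?_ ?_
  · intro S hS
    simp only [Finset.mem_filter, Finset.mem_univ, true_and] at hS ⊢
    exact Finset.notMem_erase τ S
  · intro S hS
    simp only [Finset.mem_filter, Finset.mem_univ, true_and] at hS ⊢
    exact Finset.mem_insert_self τ S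
  · intro S hS
    simp only [Finset.mem_filter, Finset.mem_univ, true_and] at hS
    exact Finset.insert_erase hS
  · intro S hS
    simp only [Finset.mem_filter, Finset.mem_univ, true_and] at hS
    exact Finset.erase_insert hS
  · intro S _; rfl

omit [DecidableEq ι] in
/-- **The hereditary bound**: for `Adm` hereditary and non-negative triple weights,
`∑_S |c_S|² ∑_{τ∈S} wt_τ ≤ (∑_τ wt_τ|κ_τ|²) ∑_S |c_S|²` (free the distinguished triple).
[cite: BastiCenatiempoSchlein2021, §5.1 (5.3)] -/
theorem sum_normSq_setCoeff_mul_sum_le (hher : ∀ S, Adm S → ∀ τ ∈ S, Adm (S.erase τ))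
    (wt : T → ℝ) (hwt : ∀ τ, 0 ≤ wt τ) :
    ∑ S : Finset T, ‖setCoeff κ Adm S‖ ^ 2 * ∑ τ ∈ S, wt τ ≤
      (∑ τ, wt τ * ‖κ τ‖ ^ 2) * ∑ S : Finset T, ‖setCoeff κ Adm S‖ ^ 2 := by
  -- rewrite the inner sums as sums over all `τ` with an indicator, then swap
  have h1 : ∀ S : Finset T, ‖setCoeff κ Adm S‖ ^ 2 * ∑ τ ∈ S, wt τ =
      ∑ τ, if τ ∈ S then wt τ * ‖setCoeff κ Adm S‖ ^ 2 else 0 := by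
    intro S
    rw [Finset.mul_sum, ← Finset.sum_filter]
    have : Finset.univ.filter (fun τ => τ ∈ S) = S := by ext τ; simp
    rw [this]
    refine Finset.sum_congr rfl fun τ _ => ?_
    ring
  simp only [h1]
  rw [Finset.sum_comm, Finset.sum_mul]
  refine Finset.sum_le_sum fun τ _ => ?_
  -- for fixed `τ`: bound each admissible term by `|κ_τ|² |c_{S∖τ}|²`
  calc ∑ S : Finset T, (if τ ∈ S then wt τ * ‖setCoeff κ Adm S‖ ^ 2 else 0)
      ≤ ∑ S : Finset T, (if τ ∈ S then wt τ * (‖κ τ‖ ^ 2 * ‖setCoeff κ Adm (S.erase τ)‖ ^ 2) else 0) := by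
        refine Finset.sum_le_sum fun S _ => ?_
        split_ifs with hτ
        · by_cases hS : Adm S
          · rw [normSq_setCoeff_eq_of_mem hher hS hτ]
          · rw [setCoeff_of_not hS, norm_zero, zero_pow two_ne_zero, mul_zero]
            exact mul_nonneg (hwt τ) (by positivity)
        · exact le_rfl
    _ = wt τ * ‖κ τ‖ ^ 2 * ∑ S ∈ Finset.univ.filter (fun S : Finset T => τ ∉ S),
          ‖setCoeff κ Adm S‖ ^ 2 := by
        rw [← Finset.sum_filter, ← sum_filter_mem_erase τ (fun S => ‖setCoeff κ Adm S‖ ^ 2),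
          Finset.mul_sum]
        refine Finset.sum_congr rfl fun S _ => ?_
        ring
    _ ≤ wt τ * ‖κ τ‖ ^ 2 * ∑ S : Finset T, ‖setCoeff κ Adm S‖ ^ 2 := by
        refine mul_le_mul_of_nonneg_left ?_ (mul_nonneg (hwt τ) (by positivity))
        exact Finset.sum_le_sum_of_subset_of_nonneg (Finset.filter_subset _ _)
          fun S _ _ => by positivity

/-- **`⟨ξ, ∑ w_pa†_pa_p ξ⟩ ≤ (∑_τ (w_{u_τ}+w_{a_τ}+w_{b_τ})|κ_τ|²) ‖ξ‖²`** for non-negative mode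
weights, a hereditary cutoff, unique pairing and squarefree occupations: the kinetic-energy bound
`⟨ξ_ν,𝒦ξ_ν⟩ ≤ (2/N)∑ r²η_r(η_r+η_{r+v})σ_v²‖ξ_ν‖² + ℰ` of [ibid., (5.3) = (eq:K)] and, with `w = 1`,
the number bound `⟨ξ_ν,𝒩ξ_ν⟩ ≤ 3(∑|κ|²)‖ξ_ν‖²` of [ibid., Prop. 2.3 (2.17), j = 1] in exact form.
[cite: BastiCenatiempoSchlein2021, §5.1 (5.3), Prop. 2.3] -/
theorem sum_mul_fockInner_pderiv_setVector_le [Fintype ι]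
    (hinj : ∀ S S', Adm S → Adm S' → setOcc u a b S = setOcc u a b S' → S = S')
    (hsq : ∀ S, Adm S → ∀ i, setOcc u a b S i ≤ 1)
    (hher : ∀ S, Adm S → ∀ τ ∈ S, Adm (S.erase τ)) (w : ι → ℝ) (hw : ∀ p, 0 ≤ w p) :
    ∑ p, w p * (fockInner (pderiv p (setVector u a b κ Adm)) (pderiv p (setVector u a b κ Adm))).re ≤
      (∑ τ, (w (u τ) + w (a τ) + w (b τ)) * ‖κ τ‖ ^ 2) *
        (fockInner (setVector u a b κ Adm) (setVector u a b κ Adm)).re := by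
  rw [sum_mul_fockInner_pderiv_setVector hinj hsq w, fockInner_setVector_self_of_squarefree hinj
    (fun S hS => occFactorial_eq_one_of_le_one (hsq S hS)), Complex.re_sum]
  simp only [Complex.conj_mul', ← Complex.ofReal_pow, Complex.ofReal_re]
  exact sum_normSq_setCoeff_mul_sum_le hher (fun τ => w (u τ) + w (a τ) + w (b τ))
    fun τ => add_nonneg (add_nonneg (hw _) (hw _)) (hw _)

end Hereditary

/-! ### Gradings and support of the set vector -/

section Grading

variable {u a b : T → ι} {κ : T → ℂ} {Adm : Finset T → Prop} [DecidablePred Adm]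

omit [DecidableEq ι] [Fintype T] in
/-- The weight of `d(S)` for an additive weight vanishing on every triple is `0`. [folklore] -/
theorem weight_setOcc_eq_zero {M : Type*} [AddCommMonoid M] (w : ι → M)
    (hw : ∀ τ, w (u τ) + w (a τ) + w (b τ) = 0) (S : Finset T) :
    Finsupp.weight w (setOcc u a b S) = 0 := by
  unfold setOcc tripleOcc
  rw [map_sum]
  refine Finset.sum_eq_zero fun τ _ => ?_
  simp only [map_add, Finsupp.weight_single, one_smul, hw]

omit [DecidableEq ι] in
/-- **The set vector is graded**: for every additive weight `w` on the modes that vanishes on each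
triple (`w(u_τ) + w(a_τ) + w(b_τ) = 0`: total momentum `e`, since `(r+v) + (-r) + (-v) = 0`; the
`P_H`/`P_S` counting weight `1, 1, -2`; the constant weight `1 ∈ ℤ/3ℤ`), `ξ` is weighted-homogeneous
of weight `0`. [cite: BastiCenatiempoSchlein2021, §4 ("`ξ_ν` is a superposition of vectors with
`2m` particles with momenta in `P_H` and `m` particles with momenta in `P_S`")] -/
theorem isWeightedHomogeneous_setVector {M : Type*} [AddCommMonoid M] (w : ι → M)
    (hw : ∀ τ, w (u τ) + w (a τ) + w (b τ) = 0) :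
    IsWeightedHomogeneous w (setVector u a b κ Adm) 0 := by
  unfold setVector
  refine IsWeightedHomogeneous.sum _ _ _ fun S _ => ?_
  exact isWeightedHomogeneous_monomial w _ _ (weight_setOcc_eq_zero w hw S)

omit [DecidableEq ι] in
/-- **Support**: `a_pξ = 0` for a mode `p` occupied by no triple (for `ξ_ν`: `a_pξ_ν = 0` unless
`p ∈ P_S ∪ P_H`, in particular `a_0ξ_ν = 0`). [cite: BastiCenatiempoSchlein2021, §4 (`a_0ξ_ν = 0`,
"`⟨ξ_ν, a†_pa_pξ_ν⟩ = 0` if `p ∈ Λ*₊∖(P_S ∪ P_H)`")] -/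
theorem pderiv_setVector_eq_zero {p : ι} (hp : ∀ τ, u τ ≠ p ∧ a τ ≠ p ∧ b τ ≠ p) :
    pderiv p (setVector u a b κ Adm) = 0 := by
  rw [pderiv_setVector]
  refine Finset.sum_eq_zero fun S _ => ?_
  have h0 : setOcc u a b S p = 0 := by
    unfold setOcc tripleOcc
    rw [Finsupp.finsetSum_apply]
    refine Finset.sum_eq_zero fun τ _ => ?_
    obtain ⟨h1, h2, h3⟩ := hp τ
    simp [h1, h2, h3]
  rw [h0, Nat.cast_zero, mul_zero, monomial_zero]

end Grading

/-! ## Two annihilations: `⟨a_ya_xξ, a_{y'}a_{x'}ξ⟩` as an indicator sum over pairs of admissible sets -/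

section TwoAnnihilations

variable {u a b : T → ι} {κ : T → ℂ} {Adm : Finset T → Prop} [DecidablePred Adm]

omit [DecidableEq ι] [Fintype T] in
/-- Two annihilations of a monomial. [cite: LSSY2005, App. A (A.13)] -/
theorem pderiv_pderiv_monomial (x y : ι) (d : ι →₀ ℕ) (c : ℂ) :
    pderiv y (pderiv x (monomial d c)) =
      monomial (d - Finsupp.single x 1 - Finsupp.single y 1)
        (c * (d x : ℂ) * ((d - Finsupp.single x 1 : ι →₀ ℕ) y : ℂ)) := by
  rw [pderiv_monomial, pderiv_monomial]

omit [DecidableEq ι] [Fintype T] in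
/-- For a squarefree `d` and `x ≠ y` occupied: `d - δ_x - δ_y + δ_x + δ_y = d`. [folklore] -/
theorem tsub_tsub_add_add_of_mem {d : ι →₀ ℕ} {x y : ι} (hxy : x ≠ y) (hx : 1 ≤ d x) (hy : 1 ≤ d y) :
    d - Finsupp.single x 1 - Finsupp.single y 1 + (Finsupp.single x 1 + Finsupp.single y 1) = d := by
  classical
  have h1 : Finsupp.single y 1 ≤ d - Finsupp.single x 1 := by
    rw [Finsupp.single_le_iff, Finsupp.tsub_apply, Finsupp.single_apply, if_neg hxy]
    simpa using hy
  have h2 : Finsupp.single x 1 ≤ d := Finsupp.single_le_iff.2 hx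
  rw [add_comm (Finsupp.single x 1), ← add_assoc, tsub_add_cancel_of_le h1, tsub_add_cancel_of_le h2]

/-- **`⟨a_ya_xξ, a_{y'}a_{x'}ξ⟩` for the set vector** (`x ≠ y`, `x' ≠ y'`, unique pairing and
squarefree occupations): the pair `(S, S')` contributes `conj(c_S)c_{S'}` exactly when `x, y` are
occupied in `S`, `x', y'` in `S'` and `d(S) + δ_{x'} + δ_{y'} = d(S') + δ_x + δ_y`.
[cite: BastiCenatiempoSchlein2021, §5.3 (5.12) (pairing structure of `⟨ξ_ν, 𝒱_N^{(H)}ξ_ν⟩`)] -/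
theorem fockInner_pderiv_pderiv_setVector
    (hsq : ∀ S, Adm S → ∀ i, setOcc u a b S i ≤ 1) {x y x' y' : ι} (hxy : x ≠ y) (hxy' : x' ≠ y') :
    fockInner (pderiv y (pderiv x (setVector u a b κ Adm))) (pderiv y' (pderiv x' (setVector u a b κ Adm))) =
      ∑ S : Finset T, ∑ S' : Finset T,
        if Adm S ∧ Adm S' ∧ setOcc u a b S x = 1 ∧ setOcc u a b S y = 1 ∧ setOcc u a b S' x' = 1 ∧
            setOcc u a b S' y' = 1 ∧
            setOcc u a b S + (Finsupp.single x' 1 + Finsupp.single y' 1) =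
              setOcc u a b S' + (Finsupp.single x 1 + Finsupp.single y 1)
        then conj (setCoeff κ Adm S) * setCoeff κ Adm S' else 0 := by
  classical
  unfold setVector
  simp only [map_sum, pderiv_pderiv_monomial]
  rw [fockInner_sum_left]
  refine Finset.sum_congr rfl fun S _ => ?_
  rw [fockInner_sum_right]
  refine Finset.sum_congr rfl fun S' _ => ?_
  rw [fockInner_monomial]
  by_cases hA : Adm S
  · by_cases hA' : Adm S'
    · -- occupations are `0` or `1`
      have hSx := hsq S hA x; have hSy := hsq S hA y; have hS'x := hsq S' hA' x'; have hS'y := hsq S' hA' y'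
      have hyv : (setOcc u a b S - Finsupp.single x 1 : ι →₀ ℕ) y = setOcc u a b S y := by
        rw [Finsupp.tsub_apply, Finsupp.single_apply, if_neg hxy, Nat.sub_zero]
      have hyv' : (setOcc u a b S' - Finsupp.single x' 1 : ι →₀ ℕ) y' = setOcc u a b S' y' := by
        rw [Finsupp.tsub_apply, Finsupp.single_apply, if_neg hxy', Nat.sub_zero]
      rw [hyv, hyv']
      by_cases hx1 : setOcc u a b S x = 1
      · by_cases hy1 : setOcc u a b S y = 1
        · by_cases hx1' : setOcc u a b S' x' = 1
          · by_cases hy1' : setOcc u a b S' y' = 1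
            · -- the genuine case: compare the two occupation conditions
              simp only [hA, hA', hx1, hy1, hx1', hy1', true_and, Nat.cast_one, mul_one]
              have hiff : setOcc u a b S - Finsupp.single x 1 - Finsupp.single y 1 =
                  setOcc u a b S' - Finsupp.single x' 1 - Finsupp.single y' 1 ↔
                  setOcc u a b S + (Finsupp.single x' 1 + Finsupp.single y' 1) =
                    setOcc u a b S' + (Finsupp.single x 1 + Finsupp.single y 1) := by
                have e1 := tsub_tsub_add_add_of_mem hxy hx1.ge hy1.ge
                have e2 := tsub_tsub_add_add_of_mem hxy' hx1'.ge hy1'.ge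
                set P := Finsupp.single x 1 + Finsupp.single y 1 with hP
                set P' := Finsupp.single x' 1 + Finsupp.single y' 1 with hP'
                constructor
                · intro h
                  calc setOcc u a b S + P'
                      = (setOcc u a b S - Finsupp.single x 1 - Finsupp.single y 1 + P) + P' := by rw [e1]
                    _ = (setOcc u a b S' - Finsupp.single x' 1 - Finsupp.single y' 1 + P) + P' := by rw [h]
                    _ = setOcc u a b S' - Finsupp.single x' 1 - Finsupp.single y' 1 + (P' + P) := by
                        rw [add_assoc, add_comm P P']
                    _ = (setOcc u a b S' - Finsupp.single x' 1 - Finsupp.single y' 1 + P') + P := by rw [← add_assoc]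
                    _ = setOcc u a b S' + P := by rw [e2]
                · intro h
                  have h' : setOcc u a b S - Finsupp.single x 1 - Finsupp.single y 1 + (P + P') =
                      setOcc u a b S' - Finsupp.single x' 1 - Finsupp.single y' 1 + (P + P') := by
                    calc setOcc u a b S - Finsupp.single x 1 - Finsupp.single y 1 + (P + P')
                        = (setOcc u a b S - Finsupp.single x 1 - Finsupp.single y 1 + P) + P' := (add_assoc _ _ _).symm
                      _ = setOcc u a b S + P' := by rw [e1]
                      _ = setOcc u a b S' + P := h
                      _ = (setOcc u a b S' - Finsupp.single x' 1 - Finsupp.single y' 1 + P') + P := by rw [e2]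
                      _ = setOcc u a b S' - Finsupp.single x' 1 - Finsupp.single y' 1 + (P + P') := by
                          rw [add_assoc, add_comm P' P]
                  exact add_right_cancel h'
              by_cases hocc : setOcc u a b S - Finsupp.single x 1 - Finsupp.single y 1 =
                  setOcc u a b S' - Finsupp.single x' 1 - Finsupp.single y' 1
              · rw [if_pos hocc, if_pos (hiff.1 hocc)]
                have hsq' : occFactorial (setOcc u a b S - Finsupp.single x 1 - Finsupp.single y 1) = 1 :=
                  occFactorial_eq_one_of_le_one fun i =>
                    (tsub_single_le_one (fun j => tsub_single_le_one (hsq S hA) x j) y i)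
                rw [hsq', Nat.cast_one, one_mul]
              · rw [if_neg hocc, if_neg (fun h => hocc (hiff.2 h))]
            · have h0 : setOcc u a b S' y' = 0 := by omega
              simp [h0]
          · have h0 : setOcc u a b S' x' = 0 := by omega
            simp [h0]
        · have h0 : setOcc u a b S y = 0 := by omega
          simp [h0]
      · have h0 : setOcc u a b S x = 0 := by omega
        simp [h0]
    · rw [setCoeff_of_not hA']
      simp [hA']
  · rw [setCoeff_of_not hA]
    simp [hA]

end TwoAnnihilations

/-! ## The momentum instance: oriented triples `(u,a,b) = (r+v, -r, -v)` and the cutoff `θ` -/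

section MomentumTriples

variable [LinearOrder ι] {e : ι → Momentum} {PH PS : Finset ι}

/-- **Oriented triples of modes**: `τ = (u, a, b)` with `u, a ∈ P_H`, `b ∈ P_S`,
`e u + e a + e b = 0` and `u < a` (for a fixed linear order on the modes). With `u = r+v`,
`a = -r`, `b = -v` these are the triples created by
`A_ν = N^{-1/2}∑_{r∈P_H, v∈P_S, r+v∈P_H} η_rσ_v a†_{r+v}a†_{-r}a†_{-v}Θ_{r,v}`; the orientation
`u < a` identifies `(r, v)` with `(-r-v, v)`, which create the same three modes.
[cite: BastiCenatiempoSchlein2021, (2.12)] -/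
def IsTriple (e : ι → Momentum) (PH PS : Finset ι) (τ : ι × ι × ι) : Prop :=
  τ.1 ∈ PH ∧ τ.2.1 ∈ PH ∧ τ.2.2 ∈ PS ∧ e τ.1 + e τ.2.1 + e τ.2.2 = 0 ∧ τ.1 < τ.2.1

/-- Being a triple is decidable. [folklore] -/
instance IsTriple.decidable (τ : ι × ι × ι) : Decidable (IsTriple e PH PS τ) := by
  unfold IsTriple; infer_instance

/-- The finite type of oriented triples. [cite: BastiCenatiempoSchlein2021, (2.12)] -/
def Triple (e : ι → Momentum) (PH PS : Finset ι) : Type _ := {τ : ι × ι × ι // IsTriple e PH PS τ}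

/-- Finitely many triples on finitely many modes. [folklore] -/
instance Triple.fintype [Fintype ι] : Fintype (Triple e PH PS) := by
  unfold Triple; infer_instance

/-- Equality of triples is decidable. [folklore] -/
instance Triple.decidableEq : DecidableEq (Triple e PH PS) := by
  unfold Triple; infer_instance

/-- The slot `u = r+v ∈ P_H`. [cite: BastiCenatiempoSchlein2021, (2.12)] -/
def Triple.u (τ : Triple e PH PS) : ι := τ.1.1
/-- The slot `a = -r ∈ P_H`. [cite: BastiCenatiempoSchlein2021, (2.12)] -/
def Triple.a (τ : Triple e PH PS) : ι := τ.1.2.1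
/-- The slot `b = -v ∈ P_S`. [cite: BastiCenatiempoSchlein2021, (2.12)] -/
def Triple.b (τ : Triple e PH PS) : ι := τ.1.2.2

omit [DecidableEq ι] in
/-- Slot memberships and the momentum constraint of a triple. [cite: BastiCenatiempoSchlein2021, (2.12)] -/
theorem Triple.prop (τ : Triple e PH PS) :
    τ.u ∈ PH ∧ τ.a ∈ PH ∧ τ.b ∈ PS ∧ e τ.u + e τ.a + e τ.b = 0 ∧ τ.u < τ.a := τ.2

omit [DecidableEq ι] in
/-- Two triples with the same slots are equal. [folklore] -/
theorem Triple.ext' {τ τ' : Triple e PH PS} (hu : τ.u = τ'.u) (ha : τ.a = τ'.a) (hb : τ.b = τ'.b) :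
    τ = τ' := by
  apply Subtype.ext
  exact Prod.ext hu (Prod.ext ha hb)

/-- **The cutoff `θ` as an admissibility predicate on sets of triples**: for all triples
`τᵢ, τⱼ, τₖ ∈ S` with `τⱼ ≠ τₖ` and all `pᵢ ∈ {uᵢ, aᵢ}`, `pₖ ∈ {uₖ, aₖ}`:
`e pᵢ + e pₖ + e bⱼ ≠ 0`, i.e. `-pᵢ + vⱼ ≠ pₖ` in the notation of
`θ({r_j,v_j}) = ∏_{i,j,k; j≠k} ∏_{pᵢ∈{-rᵢ,rᵢ+vᵢ}, pₖ∈{-rₖ,rₖ+vₖ}} δ_{-pᵢ+vⱼ ≠ pₖ}`.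
[cite: BastiCenatiempoSchlein2021, (2.13) (`θ`), (2.12) (`Θ_{r,v}`)] -/
def TripleAdm (e : ι → Momentum) (S : Finset (Triple e PH PS)) : Prop :=
  ∀ τi ∈ S, ∀ τj ∈ S, ∀ τk ∈ S, τj ≠ τk →
    ∀ pi ∈ ({τi.u, τi.a} : Finset ι), ∀ pk ∈ ({τk.u, τk.a} : Finset ι), e pi + e pk + e τj.b ≠ 0

/-- The cutoff is decidable. [folklore] -/
instance TripleAdm.decidable (S : Finset (Triple e PH PS)) : Decidable (TripleAdm e S) := by
  unfold TripleAdm; infer_instance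

/-- **`θ` is hereditary** (monotone under inclusion). [cite: BastiCenatiempoSchlein2021, §5.1
("`θ({r_j,v_j}_{j=1}^m) ≤ θ({r_j,v_j}_{j=1}^{m-1})`")] -/
theorem TripleAdm.mono {S S' : Finset (Triple e PH PS)} (h : S' ⊆ S) (hS : TripleAdm e S) :
    TripleAdm e S' :=
  fun τi hi τj hj τk hk hjk => hS τi (h hi) τj (h hj) τk (h hk) hjk

/-- `θ` passes to `S ∖ τ`. [cite: BastiCenatiempoSchlein2021, §5.1] -/
theorem TripleAdm.erase {S : Finset (Triple e PH PS)} (hS : TripleAdm e S) (τ : Triple e PH PS) :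
    TripleAdm e (S.erase τ) :=
  hS.mono (Finset.erase_subset τ S)

/-- **Distinct soft momenta**: in an admissible set the `b`-slots are pairwise distinct
(`vⱼ ≠ vₖ`, from `i = k`, `pᵢ = uₖ`, `pₖ = aₖ`: `e uₖ + e aₖ + e bⱼ = e bⱼ - e bₖ`).
[cite: BastiCenatiempoSchlein2021, after (2.12) ("restrictions of the form `v_m ≠ v_i`")] -/
theorem TripleAdm.b_injOn {S : Finset (Triple e PH PS)}
    (hS : TripleAdm e S) {τj τk : Triple e PH PS} (hj : τj ∈ S) (hk : τk ∈ S) (hb : τj.b = τk.b) :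
    τj = τk := by
  by_contra hjk
  have h := hS τk hk τj hj τk hk hjk τk.u (by simp) τk.a (by simp)
  apply h
  have hk0 := τk.prop.2.2.2.1
  rw [hb]
  exact hk0

/-- **Distinct hard momenta across triples**: for `τᵢ ≠ τₖ` in an admissible set,
`{uᵢ, aᵢ} ∩ {uₖ, aₖ} = ∅` ("`p_m ≠ p_i`"). [cite: BastiCenatiempoSchlein2021, after (2.12)] -/
theorem TripleAdm.hard_ne {S : Finset (Triple e PH PS)} (hS : TripleAdm e S)
    {τi τk : Triple e PH PS} (hi : τi ∈ S) (hk : τk ∈ S) (hik : τi ≠ τk)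
    {p : ι} (hpi : p ∈ ({τi.u, τi.a} : Finset ι)) (hpk : p ∈ ({τk.u, τk.a} : Finset ι)) : False := by
  -- the complementary slot `p'` of `τᵢ` gives `e p' + e p + e bᵢ = 0`
  have hsum := τi.prop.2.2.2.1
  simp only [Finset.mem_insert, Finset.mem_singleton] at hpi
  rcases hpi with rfl | rfl
  · exact hS τi hi τi hi τk hk hik τi.a (by simp) τi.u hpk (by rw [← hsum]; abel)
  · exact hS τi hi τi hi τk hk hik τi.u (by simp) τi.a hpk (by rw [← hsum])

/-- The occupation of a mode counts the triples of `S` having it as a slot. [folklore] -/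
theorem setOcc_triple_apply (S : Finset (Triple e PH PS)) (i : ι) :
    setOcc Triple.u Triple.a Triple.b S i =
      ∑ τ ∈ S, ((if τ.u = i then 1 else 0) + (if τ.a = i then 1 else 0) + (if τ.b = i then 1 else 0)) := by
  unfold setOcc tripleOcc
  rw [Finsupp.finsetSum_apply]
  refine Finset.sum_congr rfl fun τ _ => ?_
  simp only [Finsupp.coe_add, Pi.add_apply, Finsupp.single_apply]

/-- A mode with non-zero occupation is a slot of some triple of `S`. [folklore] -/
theorem exists_slot_of_setOcc_ne_zero {S : Finset (Triple e PH PS)} {i : ι}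
    (h : setOcc Triple.u Triple.a Triple.b S i ≠ 0) :
    ∃ τ ∈ S, τ.u = i ∨ τ.a = i ∨ τ.b = i := by
  rw [setOcc_triple_apply] at h
  obtain ⟨τ, hτ, hne⟩ := Finset.exists_ne_zero_of_sum_ne_zero h
  refine ⟨τ, hτ, ?_⟩
  by_contra hno
  push Not at hno
  rw [if_neg hno.1, if_neg hno.2.1, if_neg hno.2.2] at hne
  exact hne rfl

/-- **Squarefree occupations**: in an admissible set with `P_H ∩ P_S = ∅` every mode is occupied at
most once. [cite: BastiCenatiempoSchlein2021, after (2.15) ("up to permutations, the pairing of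
the momenta in `P_S` is unique")] -/
theorem TripleAdm.setOcc_le_one (hHS : Disjoint PH PS)
    {S : Finset (Triple e PH PS)} (hS : TripleAdm e S) (i : ι) :
    setOcc Triple.u Triple.a Triple.b S i ≤ 1 := by
  induction S using Finset.induction_on with
  | empty => simp [setOcc]
  | insert τ S hτS ih =>
    have hS' : TripleAdm e S := hS.mono (Finset.subset_insert τ S)
    have hτ := τ.prop
    rw [setOcc, Finset.sum_insert hτS, ← setOcc, Finsupp.add_apply]
    -- occupation of `i` in `τ` alone
    have hone : tripleOcc Triple.u Triple.a Triple.b τ i =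
        (if τ.u = i then 1 else 0) + (if τ.a = i then 1 else 0) + (if τ.b = i then 1 else 0) := by
      simp only [tripleOcc, Finsupp.coe_add, Pi.add_apply, Finsupp.single_apply]
    have hua : τ.u ≠ τ.a := ne_of_lt hτ.2.2.2.2
    have hub : τ.u ≠ τ.b := fun h => Finset.disjoint_left.1 hHS hτ.1 (h ▸ hτ.2.2.1)
    have hab : τ.a ≠ τ.b := fun h => Finset.disjoint_left.1 hHS hτ.2.1 (h ▸ hτ.2.2.1)
    by_cases hi : τ.u = i ∨ τ.a = i ∨ τ.b = i
    · -- `i` is a slot of `τ`: then no triple of `S` has it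
      have hzero : setOcc Triple.u Triple.a Triple.b S i = 0 := by
        by_contra hne
        obtain ⟨τ', hτ', hi'⟩ := exists_slot_of_setOcc_ne_zero hne
        have hne' : τ ≠ τ' := fun h => hτS (h ▸ hτ')
        have hτm : τ ∈ insert τ S := Finset.mem_insert_self τ S
        have hτ'm : τ' ∈ insert τ S := Finset.mem_insert_of_mem hτ'
        have hτ'p := τ'.prop
        -- case analysis on the two slots
        rcases hi with h1 | h1 | h1 <;> rcases hi' with h2 | h2 | h2
        · exact hS.hard_ne hτm hτ'm hne' (p := i) (by simp [h1]) (by simp [h2])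
        · exact hS.hard_ne hτm hτ'm hne' (p := i) (by simp [h1]) (by simp [h2])
        · exact Finset.disjoint_left.1 hHS (h1 ▸ hτ.1) (h2 ▸ hτ'p.2.2.1)
        · exact hS.hard_ne hτm hτ'm hne' (p := i) (by simp [h1]) (by simp [h2])
        · exact hS.hard_ne hτm hτ'm hne' (p := i) (by simp [h1]) (by simp [h2])
        · exact Finset.disjoint_left.1 hHS (h1 ▸ hτ.2.1) (h2 ▸ hτ'p.2.2.1)
        · exact Finset.disjoint_left.1 hHS (h2 ▸ hτ'p.1) (h1 ▸ hτ.2.2.1)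
        · exact Finset.disjoint_left.1 hHS (h2 ▸ hτ'p.2.1) (h1 ▸ hτ.2.2.1)
        · exact hne' (hS.b_injOn hτm hτ'm (h1.trans h2.symm))
      rw [hzero, add_zero, hone]
      rcases hi with h1 | h1 | h1
      · rw [if_pos h1, if_neg (fun h => hua (h1.trans h.symm)), if_neg (fun h => hub (h1.trans h.symm))]
      · rw [if_neg (fun h => hua (h.trans h1.symm)), if_pos h1, if_neg (fun h => hab (h1.trans h.symm))]
      · rw [if_neg (fun h => hub (h.trans h1.symm)), if_neg (fun h => hab (h.trans h1.symm)), if_pos h1]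
    · push Not at hi
      rw [hone, if_neg hi.1, if_neg hi.2.1, if_neg hi.2.2]
      simpa using ih hS'

/-- The three slots of a member triple are occupied. [folklore] -/
theorem setOcc_slot_ne_zero {S : Finset (Triple e PH PS)} {τ : Triple e PH PS} (hτ : τ ∈ S) :
    setOcc Triple.u Triple.a Triple.b S τ.u ≠ 0 ∧ setOcc Triple.u Triple.a Triple.b S τ.a ≠ 0 ∧
      setOcc Triple.u Triple.a Triple.b S τ.b ≠ 0 := by
  have hle : ∀ i, tripleOcc Triple.u Triple.a Triple.b τ i ≤ setOcc Triple.u Triple.a Triple.b S i := by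
    intro i
    rw [setOcc, Finsupp.finsetSum_apply]
    exact Finset.single_le_sum (f := fun τ' => tripleOcc Triple.u Triple.a Triple.b τ' i)
      (fun _ _ => Nat.zero_le _) hτ
  have hu : 1 ≤ tripleOcc Triple.u Triple.a Triple.b τ τ.u := by
    simp only [tripleOcc, Finsupp.coe_add, Pi.add_apply, Finsupp.single_apply, if_true]
    split_ifs <;> omega
  have ha : 1 ≤ tripleOcc Triple.u Triple.a Triple.b τ τ.a := by
    simp only [tripleOcc, Finsupp.coe_add, Pi.add_apply, Finsupp.single_apply, if_true]
    split_ifs <;> omega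
  have hb : 1 ≤ tripleOcc Triple.u Triple.a Triple.b τ τ.b := by
    simp only [tripleOcc, Finsupp.coe_add, Pi.add_apply, Finsupp.single_apply, if_true]
    split_ifs <;> omega
  exact ⟨Nat.one_le_iff_ne_zero.1 (hu.trans (hle _)), Nat.one_le_iff_ne_zero.1 (ha.trans (hle _)),
    Nat.one_le_iff_ne_zero.1 (hb.trans (hle _))⟩

/-- **Unique pairing, one inclusion**: if `S` is admissible and `S'` (any set of triples) has the
same occupation vector, then `S' ⊆ S` — a triple of `S'` reads its soft slot off a unique `bⱼ`
of `S` and its two hard slots off `{uᵢ,aᵢ}`, `{uₖ,aₖ}`; the momentum constraint of the triple is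
a relation `e pᵢ + e pₖ + e bⱼ = 0`, which `θ` forbids unless `i = j = k`, and the orientation
fixes the order. [cite: BastiCenatiempoSchlein2021, after (2.15) ("if this was not the case, we
would have … all of which are forbidden by the cutoff")] -/
theorem TripleAdm.subset_of_setOcc_eq (hHS : Disjoint PH PS) {S S' : Finset (Triple e PH PS)}
    (hS : TripleAdm e S)
    (hocc : setOcc Triple.u Triple.a Triple.b S = setOcc Triple.u Triple.a Triple.b S') :
    S' ⊆ S := by
  intro τ' hτ'
  obtain ⟨hu', ha', hb', hsum', hlt'⟩ := τ'.prop
  obtain ⟨hoU, hoA, hoB⟩ := setOcc_slot_ne_zero hτ'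
  rw [← hocc] at hoU hoA hoB
  obtain ⟨τi, hi, hiu⟩ := exists_slot_of_setOcc_ne_zero hoU
  obtain ⟨τk, hk, hka⟩ := exists_slot_of_setOcc_ne_zero hoA
  obtain ⟨τj, hj, hjb⟩ := exists_slot_of_setOcc_ne_zero hoB
  have hpi := τi.prop; have hpk := τk.prop; have hpj := τj.prop
  -- the soft slot of `τ'` is the soft slot of `τⱼ`
  have hjb' : τj.b = τ'.b := by
    rcases hjb with h | h | h
    · exact absurd (h ▸ hpj.1) (Finset.disjoint_right.1 hHS hb')
    · exact absurd (h ▸ hpj.2.1) (Finset.disjoint_right.1 hHS hb')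
    · exact h
  -- the hard slots of `τ'` are hard slots of `τᵢ`, `τₖ`
  have hiu' : τ'.u ∈ ({τi.u, τi.a} : Finset ι) := by
    rcases hiu with h | h | h
    · simp [h]
    · simp [h]
    · exact absurd (h ▸ hpi.2.2.1) (Finset.disjoint_left.1 hHS hu')
  have hka' : τ'.a ∈ ({τk.u, τk.a} : Finset ι) := by
    rcases hka with h | h | h
    · simp [h]
    · simp [h]
    · exact absurd (h ▸ hpk.2.2.1) (Finset.disjoint_left.1 hHS ha')
  -- `θ` forces `j = k` and `j = i`
  have hjk : τj = τk := by
    by_contra hjk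
    exact hS τi hi τj hj τk hk hjk τ'.u hiu' τ'.a hka' (by rw [hjb']; exact hsum')
  have hji : τj = τi := by
    by_contra hji
    refine hS τk hk τj hj τi hi hji τ'.a hka' τ'.u hiu' ?_
    rw [hjb', add_comm (e τ'.a)]; exact hsum'
  subst hjk; subst hji
  -- orientation
  simp only [Finset.mem_insert, Finset.mem_singleton] at hiu' hka'
  have hlt := hpj.2.2.2.2
  rcases hiu' with h1 | h1 <;> rcases hka' with h2 | h2
  · exact absurd (h1.trans h2.symm) (ne_of_lt hlt')
  · rw [Triple.ext' h1 h2 hjb'.symm]; exact hj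
  · rw [h1, h2] at hlt'; exact absurd hlt (lt_asymm hlt')
  · exact absurd (h1.trans h2.symm) (ne_of_lt hlt')

/-- **Unique pairing**: two admissible sets of triples with the same occupation vector coincide
(with `P_H ∩ P_S = ∅`); hence distinct admissible sets give orthogonal monomials.
[cite: BastiCenatiempoSchlein2021, after (2.15)] -/
theorem TripleAdm.eq_of_setOcc_eq (hHS : Disjoint PH PS) {S S' : Finset (Triple e PH PS)}
    (hS : TripleAdm e S) (hS' : TripleAdm e S')
    (hocc : setOcc Triple.u Triple.a Triple.b S = setOcc Triple.u Triple.a Triple.b S') : S = S' :=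
  Finset.Subset.antisymm (hS'.subset_of_setOcc_eq hHS hocc.symm) (hS.subset_of_setOcc_eq hHS hocc)

/-! ### The cubic vector `ξ_ν` and its exact norm, number and kinetic identities -/

/-- **The cubic trial vector** `ξ_ν = e^{A_ν}Ω = ∑_{S : θ(S)} (∏_{τ∈S} κ_τ) ∏_{τ∈S} a†_{u_τ}a†_{a_τ}a†_{b_τ}Ω`
on the modes `ι`, for hard/soft mode sets `P_H, P_S`, momentum labels `e` and triple amplitudes
`κ` (in [ibid.] `κ_{(r+v,-r,-v)} = N^{-1/2}(η_r + η_{r+v})σ_v` after identifying `r` with `-r-v`).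
[cite: BastiCenatiempoSchlein2021, (2.12)–(2.13)] -/
def cubicVector [Fintype ι] (e : ι → Momentum) (PH PS : Finset ι) (κ : Triple e PH PS → ℂ) :
    MvPolynomial ι ℂ :=
  setVector Triple.u Triple.a Triple.b κ (TripleAdm e)

/-- **(normA)** `‖ξ_ν‖² = ∑_{S : θ(S)} ∏_{τ∈S} |κ_τ|²`. [cite: BastiCenatiempoSchlein2021, (2.16)] -/
theorem fockInner_cubicVector_self [Fintype ι] (hHS : Disjoint PH PS) (κ : Triple e PH PS → ℂ) :
    fockInner (cubicVector e PH PS κ) (cubicVector e PH PS κ) =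
      ∑ S : Finset (Triple e PH PS), conj (setCoeff κ (TripleAdm e) S) * setCoeff κ (TripleAdm e) S :=
  fockInner_setVector_self_of_squarefree
    (fun _ _ hS hS' h => TripleAdm.eq_of_setOcc_eq hHS hS hS' h)
    (fun _ hS => occFactorial_eq_one_of_le_one (TripleAdm.setOcc_le_one hHS hS))

/-- **`⟨ξ_ν, ∑_p w_pa†_pa_p ξ_ν⟩ = ∑_{S : θ(S)} |c_S|² ∑_{τ∈S} (w_{u_τ} + w_{a_τ} + w_{b_τ})`** — the exact
kinetic energy (`w_p = |2πe(p)/L|²`, [ibid., (5.2)]) and particle number (`w = 1`: `3|S|`) of the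
cubic vector. [cite: BastiCenatiempoSchlein2021, §5.1 (5.2)] -/
theorem sum_mul_fockInner_pderiv_cubicVector [Fintype ι] (hHS : Disjoint PH PS)
    (κ : Triple e PH PS → ℂ) (w : ι → ℝ) :
    ∑ p, w p * (fockInner (pderiv p (cubicVector e PH PS κ)) (pderiv p (cubicVector e PH PS κ))).re =
      ∑ S : Finset (Triple e PH PS), ‖setCoeff κ (TripleAdm e) S‖ ^ 2 *
        ∑ τ ∈ S, (w τ.u + w τ.a + w τ.b) :=
  sum_mul_fockInner_pderiv_setVector (fun _ _ hS hS' h => TripleAdm.eq_of_setOcc_eq hHS hS hS' h)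
    (fun _ hS => TripleAdm.setOcc_le_one hHS hS) w

/-- **`⟨ξ_ν, ∑_p w_pa†_pa_p ξ_ν⟩ ≤ (∑_τ (w_{u_τ}+w_{a_τ}+w_{b_τ})|κ_τ|²)‖ξ_ν‖²`** for `w ≥ 0`: the
kinetic bound (5.3) = (eq:K) and the number bound of Prop. 2.3 (`j = 1`) with explicit constants
and no error term. [cite: BastiCenatiempoSchlein2021, §5.1 (5.3), Prop. 2.3] -/
theorem sum_mul_fockInner_pderiv_cubicVector_le [Fintype ι] (hHS : Disjoint PH PS)
    (κ : Triple e PH PS → ℂ) (w : ι → ℝ) (hw : ∀ p, 0 ≤ w p) :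
    ∑ p, w p * (fockInner (pderiv p (cubicVector e PH PS κ)) (pderiv p (cubicVector e PH PS κ))).re ≤
      (∑ τ : Triple e PH PS, (w τ.u + w τ.a + w τ.b) * ‖κ τ‖ ^ 2) *
        (fockInner (cubicVector e PH PS κ) (cubicVector e PH PS κ)).re :=
  sum_mul_fockInner_pderiv_setVector_le (fun _ _ hS hS' h => TripleAdm.eq_of_setOcc_eq hHS hS hS' h)
    (fun _ hS => TripleAdm.setOcc_le_one hHS hS) (fun _ hS τ _ => hS.erase τ) w hw

/-- **The cubic vector has no condensate or inert excitations**: `a_pξ_ν = 0` for `p ∉ P_H ∪ P_S`.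
[cite: BastiCenatiempoSchlein2021, §4 (`a_0ξ_ν = 0`)] -/
theorem pderiv_cubicVector_eq_zero [Fintype ι] (κ : Triple e PH PS → ℂ) {p : ι} (hpH : p ∉ PH)
    (hpS : p ∉ PS) : pderiv p (cubicVector e PH PS κ) = 0 :=
  pderiv_setVector_eq_zero fun τ =>
    ⟨fun h => hpH (h ▸ τ.prop.1), fun h => hpH (h ▸ τ.prop.2.1), fun h => hpS (h ▸ τ.prop.2.2.1)⟩

/-- **The cubic vector has total momentum zero** (weight `e`), **is `3ℤ`-graded in the particle
number** and **balanced between `P_H` and `P_S`**: for every additive weight vanishing on all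
triples it is weighted-homogeneous of weight `0`. [cite: BastiCenatiempoSchlein2021, §4] -/
theorem isWeightedHomogeneous_cubicVector [Fintype ι] {M : Type*} [AddCommMonoid M] (κ : Triple e PH PS → ℂ)
    (w : ι → M) (hw : ∀ τ : Triple e PH PS, w τ.u + w τ.a + w τ.b = 0) :
    IsWeightedHomogeneous w (cubicVector e PH PS κ) 0 :=
  isWeightedHomogeneous_setVector w hw

/-- In particular the total momentum vanishes: weight `e`. [cite: BastiCenatiempoSchlein2021, (2.12)] -/
theorem isWeightedHomogeneous_cubicVector_momentum [Fintype ι] (κ : Triple e PH PS → ℂ) :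
    IsWeightedHomogeneous e (cubicVector e PH PS κ) 0 :=
  isWeightedHomogeneous_cubicVector κ e fun τ => τ.prop.2.2.2.1

end MomentumTriples

/-! ## Contractions of the cubic vector: generalized hereditary bound, second moment, and the
triple contraction `⟨a_ba_aa_u ξ, ξ⟩` -/

section Contractions

variable [DecidableEq T] {u a b : T → ι} {κ : T → ℂ} {Adm : Finset T → Prop} [DecidablePred Adm]

omit [DecidableEq ι] in
/-- **Generalized hereditary bound**: for `Adm` hereditary, `wt ≥ 0` on triples and `G ≥ 0` on
sets, `∑_S |c_S|² ∑_{τ∈S} wt_τ G(S∖τ) ≤ ∑_τ wt_τ|κ_τ|² ∑_{S'} |c_{S'}|² G(S')` (free the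
distinguished triple; used twice for `⟨𝒩²⟩`, and with `G` a coincidence count for the cutoff
errors). [cite: BastiCenatiempoSchlein2021, §5.1 (5.3)–(5.4)] -/
theorem sum_normSq_setCoeff_mul_sum_mul_le (hher : ∀ S, Adm S → ∀ τ ∈ S, Adm (S.erase τ))
    (wt : T → ℝ) (hwt : ∀ τ, 0 ≤ wt τ) (G : Finset T → ℝ) (hG : ∀ S, 0 ≤ G S) :
    ∑ S : Finset T, ‖setCoeff κ Adm S‖ ^ 2 * ∑ τ ∈ S, wt τ * G (S.erase τ) ≤
      ∑ τ, wt τ * ‖κ τ‖ ^ 2 * ∑ S : Finset T, ‖setCoeff κ Adm S‖ ^ 2 * G S := by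
  have h1 : ∀ S : Finset T, ‖setCoeff κ Adm S‖ ^ 2 * ∑ τ ∈ S, wt τ * G (S.erase τ) =
      ∑ τ, if τ ∈ S then wt τ * G (S.erase τ) * ‖setCoeff κ Adm S‖ ^ 2 else 0 := by
    intro S
    rw [Finset.mul_sum, ← Finset.sum_filter]
    have : Finset.univ.filter (fun τ => τ ∈ S) = S := by ext τ; simp
    rw [this]
    refine Finset.sum_congr rfl fun τ _ => ?_
    ring
  simp only [h1]
  rw [Finset.sum_comm]
  refine Finset.sum_le_sum fun τ _ => ?_
  calc ∑ S : Finset T, (if τ ∈ S then wt τ * G (S.erase τ) * ‖setCoeff κ Adm S‖ ^ 2 else 0)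
      ≤ ∑ S : Finset T, (if τ ∈ S then
          wt τ * G (S.erase τ) * (‖κ τ‖ ^ 2 * ‖setCoeff κ Adm (S.erase τ)‖ ^ 2) else 0) := by
        refine Finset.sum_le_sum fun S _ => ?_
        split_ifs with hτ
        · by_cases hS : Adm S
          · rw [normSq_setCoeff_eq_of_mem hher hS hτ]
          · rw [setCoeff_of_not hS, norm_zero, zero_pow two_ne_zero, mul_zero]
            exact mul_nonneg (mul_nonneg (hwt τ) (hG _)) (by positivity)
        · exact le_rfl
    _ = wt τ * ‖κ τ‖ ^ 2 * ∑ S ∈ Finset.univ.filter (fun S : Finset T => τ ∉ S),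
          ‖setCoeff κ Adm S‖ ^ 2 * G S := by
        rw [← Finset.sum_filter,
          ← sum_filter_mem_erase τ (fun S => ‖setCoeff κ Adm S‖ ^ 2 * G S), Finset.mul_sum]
        refine Finset.sum_congr rfl fun S _ => ?_
        ring
    _ ≤ wt τ * ‖κ τ‖ ^ 2 * ∑ S : Finset T, ‖setCoeff κ Adm S‖ ^ 2 * G S := by
        refine mul_le_mul_of_nonneg_left ?_ (mul_nonneg (hwt τ) (by positivity))
        exact Finset.sum_le_sum_of_subset_of_nonneg (Finset.filter_subset _ _)
          fun S _ _ => mul_nonneg (by positivity) (hG S)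

omit [DecidableEq ι] in
/-- **Second-moment hereditary bound**: `∑_S |c_S|² |S|(|S|-1) ≤ (∑_τ|κ_τ|²)² ∑_S |c_S|²`
(free two triples). [cite: BastiCenatiempoSchlein2021, §5.1 (5.4) ("bounding
`θ({r_j,v_j}_{j=1}^m)` by `θ({r_j,v_j}_{j=1}^{m-2})`")] -/
theorem sum_normSq_setCoeff_mul_card_mul_card_sub_one_le
    (hher : ∀ S, Adm S → ∀ τ ∈ S, Adm (S.erase τ)) :
    ∑ S : Finset T, ‖setCoeff κ Adm S‖ ^ 2 * ((S.card : ℝ) * ((S.card : ℝ) - 1)) ≤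
      (∑ τ, ‖κ τ‖ ^ 2) ^ 2 * ∑ S : Finset T, ‖setCoeff κ Adm S‖ ^ 2 := by
  -- first removal, with `G(S') = |S'|`
  have h1 := sum_normSq_setCoeff_mul_sum_mul_le (κ := κ) hher (fun _ => 1) (fun _ => zero_le_one)
    (fun S => (S.card : ℝ)) (fun S => Nat.cast_nonneg _)
  have hlhs : ∀ S : Finset T, ∑ τ ∈ S, ((S.erase τ).card : ℝ) = (S.card : ℝ) * ((S.card : ℝ) - 1) := by
    intro S
    rw [Finset.sum_congr rfl fun τ (hτ : τ ∈ S) => by rw [Finset.card_erase_of_mem hτ],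
      Finset.sum_const, nsmul_eq_mul]
    rcases Nat.eq_zero_or_pos S.card with h | h
    · rw [h]; simp
    · rw [Nat.cast_sub h]; simp
  simp only [one_mul, hlhs] at h1
  rw [← Finset.sum_mul] at h1
  -- second removal, with `G = 1`
  have h2 := sum_normSq_setCoeff_mul_sum_le (κ := κ) hher (fun _ => 1) (fun _ => zero_le_one)
  simp only [one_mul, Finset.sum_const, nsmul_eq_mul, mul_one] at h2
  have h2' : ∑ S : Finset T, ‖setCoeff κ Adm S‖ ^ 2 * (S.card : ℝ) ≤
      (∑ τ, ‖κ τ‖ ^ 2) * ∑ S : Finset T, ‖setCoeff κ Adm S‖ ^ 2 := by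
    simpa [mul_comm] using h2
  calc _ ≤ (∑ τ, ‖κ τ‖ ^ 2) * ∑ S : Finset T, ‖setCoeff κ Adm S‖ ^ 2 * (S.card : ℝ) := h1
    _ ≤ (∑ τ, ‖κ τ‖ ^ 2) * ((∑ τ, ‖κ τ‖ ^ 2) * ∑ S : Finset T, ‖setCoeff κ Adm S‖ ^ 2) :=
        mul_le_mul_of_nonneg_left h2' (Finset.sum_nonneg fun _ _ => by positivity)
    _ = _ := by ring

end Contractions

/-! ### The triple contraction `⟨ξ, a†_ua†_aa†_b ξ⟩` (only the diagonal pairing survives) -/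

section TripleContraction

variable [LinearOrder ι] {e : ι → Momentum} {PH PS : Finset ι}

omit [DecidableEq ι] [Fintype T] [LinearOrder ι] in
/-- `X_n · X^s = X^{s + δ_n}`. [folklore] -/
theorem X_mul_monomial' (n : ι) (s : ι →₀ ℕ) (c : ℂ) :
    (X n * monomial s c : MvPolynomial ι ℂ) = monomial (s + Finsupp.single n 1) c := by
  rw [← pow_one (X n), ← monomial_single_add, add_comm]

omit [DecidableEq ι] [Fintype T] in
/-- Creating an oriented triple on a monomial adds its occupation vector. [folklore] -/
theorem X_mul_X_mul_X_mul_monomial (τ₀ : Triple e PH PS) (d : ι →₀ ℕ) (c : ℂ) :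
    (X τ₀.u * (X τ₀.a * (X τ₀.b * monomial d c)) : MvPolynomial ι ℂ) =
      monomial (d + tripleOcc Triple.u Triple.a Triple.b τ₀) c := by
  rw [X_mul_monomial', X_mul_monomial', X_mul_monomial']
  congr 1
  simp only [tripleOcc]
  abel

omit [Fintype T] in
/-- Removing a member triple from the occupation vector. [folklore] -/
theorem setOcc_erase_add {S : Finset (Triple e PH PS)} {τ : Triple e PH PS} (hτ : τ ∈ S) :
    setOcc Triple.u Triple.a Triple.b (S.erase τ) + tripleOcc Triple.u Triple.a Triple.b τ =
      setOcc Triple.u Triple.a Triple.b S := by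
  unfold setOcc
  exact Finset.sum_erase_add _ _ hτ

omit [Fintype T] in
/-- Inserting a new triple into the occupation vector. [folklore] -/
theorem setOcc_insert {S : Finset (Triple e PH PS)} {τ : Triple e PH PS} (hτ : τ ∉ S) :
    setOcc Triple.u Triple.a Triple.b (insert τ S) =
      tripleOcc Triple.u Triple.a Triple.b τ + setOcc Triple.u Triple.a Triple.b S := by
  unfold setOcc
  exact Finset.sum_insert hτ

omit [Fintype T] in
/-- **No pairing creates a member triple twice**: if `S` is admissible (`P_H ∩ P_S = ∅`) and
`d(S) = d(S'') + d(τ₀)`, then `τ₀ ∈ S` and `S'' ⊆ S ∖ τ₀`-wise `d(S'') = d(S ∖ τ₀)`.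
[cite: BastiCenatiempoSchlein2021, §5.2 ("the presence of the cutoffs immediately implies that
`A_{r_j,v_j}` is fully contracted with `A†_{r_j,v_j}` for all `j ≠ m`")] -/
theorem TripleAdm.mem_of_setOcc_eq_add (hHS : Disjoint PH PS) {S S'' : Finset (Triple e PH PS)}
    (hS : TripleAdm e S) {τ₀ : Triple e PH PS}
    (h : setOcc Triple.u Triple.a Triple.b S =
      setOcc Triple.u Triple.a Triple.b S'' + tripleOcc Triple.u Triple.a Triple.b τ₀) :
    τ₀ ∈ S ∧ setOcc Triple.u Triple.a Triple.b S'' = setOcc Triple.u Triple.a Triple.b (S.erase τ₀) := by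
  -- `τ₀ ∉ S''`, else `u₀` would be doubly occupied in `S`
  have hτ₀ : τ₀ ∉ S'' := by
    intro hmem
    have h1 := (setOcc_slot_ne_zero hmem).1
    have h2 := hS.setOcc_le_one hHS τ₀.u
    rw [h, Finsupp.add_apply] at h2
    have h3 : 1 ≤ tripleOcc Triple.u Triple.a Triple.b τ₀ τ₀.u := by
      simp only [tripleOcc, Finsupp.coe_add, Pi.add_apply, Finsupp.single_apply, if_true]
      split_ifs <;> omega
    omega
  have hins : setOcc Triple.u Triple.a Triple.b S = setOcc Triple.u Triple.a Triple.b (insert τ₀ S'') := by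
    rw [setOcc_insert hτ₀, h, add_comm]
  have hsub := hS.subset_of_setOcc_eq hHS hins
  have hmem : τ₀ ∈ S := hsub (Finset.mem_insert_self τ₀ S'')
  refine ⟨hmem, ?_⟩
  have h' := setOcc_erase_add hmem
  rw [← h'] at h
  exact (add_left_injective _ h).symm

/-- **The triple contraction.** For the cubic vector and an oriented triple `τ₀ = (u,a,b)`:
`⟨ξ_ν, a†_ua†_aa†_b ξ_ν⟩ = conj(κ_{τ₀}) ∑_{S : θ(S), τ₀ ∈ S} |c_{S∖τ₀}|²` — creating `τ₀` on an
admissible `S''` and pairing with `ξ_ν` only meets `S = S'' ∪ {τ₀}`; every other contraction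
pattern is excluded by the cutoff. This is the exact form of the expectation of the cubic operator
`𝒞_N ∝ ∑ (a†_{r+v}a†_{-r}a†_{-v} + h.c.)` in `ξ_ν` before freeing the last triple
(`I_𝒞 + J_𝒞`). [cite: BastiCenatiempoSchlein2021, §5.2 (display after (5.7))] -/
theorem fockInner_cubicVector_X_mul_X_mul_X_mul [Fintype ι] (hHS : Disjoint PH PS)
    (κ : Triple e PH PS → ℂ) (τ₀ : Triple e PH PS) :
    fockInner (cubicVector e PH PS κ) (X τ₀.u * (X τ₀.a * (X τ₀.b * cubicVector e PH PS κ))) =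
      conj (κ τ₀) * ∑ S : Finset (Triple e PH PS), if TripleAdm e S ∧ τ₀ ∈ S then
        conj (setCoeff κ (TripleAdm e) (S.erase τ₀)) * setCoeff κ (TripleAdm e) (S.erase τ₀) else 0 := by
  have hinj : ∀ S S' : Finset (Triple e PH PS), TripleAdm e S → TripleAdm e S' →
      setOcc Triple.u Triple.a Triple.b S = setOcc Triple.u Triple.a Triple.b S' → S = S' :=
    fun _ _ hS hS' h => TripleAdm.eq_of_setOcc_eq hHS hS hS' h
  unfold cubicVector setVector
  simp only [Finset.mul_sum, X_mul_X_mul_X_mul_monomial]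
  rw [fockInner_sum_left]
  refine Finset.sum_congr rfl fun S _ => ?_
  rw [fockInner_sum_right]
  simp only [fockInner_monomial]
  by_cases hA : TripleAdm e S
  · by_cases hτ : τ₀ ∈ S
    · rw [if_pos ⟨hA, hτ⟩, Finset.sum_eq_single (S.erase τ₀)]
      · rw [if_pos (setOcc_erase_add hτ).symm, occFactorial_eq_one_of_le_one (hA.setOcc_le_one hHS),
          Nat.cast_one, one_mul, setCoeff_of hA, setCoeff_of (hA.erase τ₀), prod_eq_mul_prod_erase hτ,
          map_mul]
        ring
      · intro S'' _ hne
        by_cases hA'' : TripleAdm e S''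
        · rw [if_neg]
          intro h
          exact hne (hinj _ _ hA'' (hA.erase τ₀) (hA.mem_of_setOcc_eq_add hHS h).2)
        · rw [setCoeff_of_not hA'', mul_zero, mul_zero, ite_self]
      · exact fun h => absurd (Finset.mem_univ _) h
    · rw [if_neg (fun h => hτ h.2), mul_zero]
      refine Finset.sum_eq_zero fun S'' _ => ?_
      rw [if_neg]
      exact fun h => hτ (hA.mem_of_setOcc_eq_add hHS h).1
  · rw [if_neg (fun h => hA h.1), setCoeff_of_not hA, mul_zero]
    simp

/-- The annihilation form: `⟨a_ba_aa_u ξ_ν, ξ_ν⟩ = ⟨ξ_ν, a†_ua†_aa†_bξ_ν⟩`. [cite: LSSY2005, App. A (after (A.6))] -/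
theorem fockInner_pderiv_pderiv_pderiv_cubicVector [Fintype ι] (κ : Triple e PH PS → ℂ)
    (τ₀ : Triple e PH PS) :
    fockInner (pderiv τ₀.b (pderiv τ₀.a (pderiv τ₀.u (cubicVector e PH PS κ)))) (cubicVector e PH PS κ) =
      fockInner (cubicVector e PH PS κ) (X τ₀.u * (X τ₀.a * (X τ₀.b * cubicVector e PH PS κ))) := by
  rw [fockInner_X_mul_right, fockInner_X_mul_right, fockInner_X_mul_right]

end TripleContraction

/-! ### Freeing the created triple: main term and cutoff (coincidence) error -/

section Freeing

variable [LinearOrder ι] {e : ι → Momentum} {PH PS : Finset ι}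

/-- Reindexing the diagonal pairing by the smaller set: `∑_{S : θ(S), τ∈S} g(S∖τ) = ∑_{S' ∌ τ : θ(S'∪τ)} g(S')`.
[folklore] -/
theorem sum_ite_adm_mem_erase [Fintype ι] (τ : Triple e PH PS) (g : Finset (Triple e PH PS) → ℝ) :
    ∑ S : Finset (Triple e PH PS), (if TripleAdm e S ∧ τ ∈ S then g (S.erase τ) else 0) =
      ∑ S : Finset (Triple e PH PS), (if τ ∉ S ∧ TripleAdm e (insert τ S) then g S else 0) := by
  have h1 : ∀ S : Finset (Triple e PH PS), (if TripleAdm e S ∧ τ ∈ S then g (S.erase τ) else 0) =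
      if τ ∈ S then (if TripleAdm e (insert τ (S.erase τ)) then g (S.erase τ) else 0) else 0 := by
    intro S
    by_cases hτ : τ ∈ S
    · rw [Finset.insert_erase hτ]
      by_cases hA : TripleAdm e S
      · rw [if_pos ⟨hA, hτ⟩, if_pos hτ, if_pos hA]
      · rw [if_neg (fun h => hA h.1), if_pos hτ, if_neg hA]
    · rw [if_neg (fun h => hτ h.2), if_neg hτ]
  have h2 : ∀ S : Finset (Triple e PH PS), (if τ ∉ S ∧ TripleAdm e (insert τ S) then g S else 0) =
      if τ ∉ S then (if TripleAdm e (insert τ S) then g S else 0) else 0 := by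
    intro S
    by_cases hτ : τ ∈ S
    · rw [if_neg (fun h => h.1 hτ), if_neg (fun h => h hτ)]
    · by_cases hA : TripleAdm e (insert τ S)
      · rw [if_pos ⟨hτ, hA⟩, if_pos hτ, if_pos hA]
      · rw [if_neg (fun h => hA h.2), if_pos hτ, if_neg hA]
  simp only [h1, h2]
  have h := sum_filter_mem_erase τ (fun S => if TripleAdm e (insert τ S) then g S else 0)
  rw [Finset.sum_filter, Finset.sum_filter] at h
  exact h

/-- **The pairing count of a triple**: `∑_{S : θ(S), τ ∈ S} |c_{S∖τ}|² = ‖ξ_ν‖² - D_τ` with the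
**cutoff defect** `D_τ = ∑_{S : θ(S), (τ ∈ S ∨ ¬θ(S∪τ))} |c_S|² ∈ [0, ‖ξ_ν‖²]` — freeing the created
triple reconstructs the norm up to the sets incompatible with `τ` (`θ_m = 1 + [θ_m - 1]`).
[cite: BastiCenatiempoSchlein2021, §5.2 ((5.8): `θ({r_j,v_j}_{j=1}^m) = θ({r_j,v_j}_{j=1}^{m-1}) θ_m`,
`⟨ξ_ν,𝒞_Nξ_ν⟩ = I_𝒞 + J_𝒞`)] -/
theorem sum_ite_adm_mem_normSq_erase [Fintype ι] (hHS : Disjoint PH PS) (κ : Triple e PH PS → ℂ)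
    (τ : Triple e PH PS) :
    ∑ S : Finset (Triple e PH PS), (if TripleAdm e S ∧ τ ∈ S then
        ‖setCoeff κ (TripleAdm e) (S.erase τ)‖ ^ 2 else 0) =
      (∑ S : Finset (Triple e PH PS), ‖setCoeff κ (TripleAdm e) S‖ ^ 2) -
      ∑ S : Finset (Triple e PH PS), (if TripleAdm e S ∧ (τ ∈ S ∨ ¬ TripleAdm e (insert τ S)) then
        ‖setCoeff κ (TripleAdm e) S‖ ^ 2 else 0) := by
  have _ := hHS
  rw [sum_ite_adm_mem_erase τ (fun S => ‖setCoeff κ (TripleAdm e) S‖ ^ 2), eq_sub_iff_add_eq,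
    ← Finset.sum_add_distrib]
  refine Finset.sum_congr rfl fun S _ => ?_
  by_cases hA : TripleAdm e S
  · by_cases hτ : τ ∈ S
    · rw [if_neg (fun h => h.1 hτ), if_pos ⟨hA, Or.inl hτ⟩, zero_add]
    · by_cases hA' : TripleAdm e (insert τ S)
      · rw [if_pos ⟨hτ, hA'⟩, if_neg (fun h => h.2.elim hτ (fun h' => h' hA')), add_zero]
      · rw [if_neg (fun h => hA' h.2), if_pos ⟨hA, Or.inr hA'⟩, zero_add]
  · have hA' : ¬ TripleAdm e (insert τ S) := fun h => hA (h.mono (Finset.subset_insert τ S))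
    rw [if_neg (fun h => hA' h.2), if_neg (fun h => hA h.1), setCoeff_of_not hA, norm_zero,
      zero_pow two_ne_zero, add_zero]

/-- **The cubic expectation, freed**: for any weights `w_τ`,
`∑_τ w_τ ⟨ξ_ν, a†_{u_τ}a†_{a_τ}a†_{b_τ}ξ_ν⟩ = (∑_τ w_τ conj κ_τ)‖ξ_ν‖² - ∑_τ w_τ conj(κ_τ) D_τ`
(main term `I_𝒞` plus the cutoff error `J_𝒞`, whose size is controlled by
`∑_{S : θ(S)} |c_S|² ∑_{τ incompatible with S} |w_τκ_τ|`). [cite: BastiCenatiempoSchlein2021, §5.2 (5.9)–(5.10)] -/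
theorem sum_mul_fockInner_cubicVector_create [Fintype ι] (hHS : Disjoint PH PS)
    (κ : Triple e PH PS → ℂ) (w : Triple e PH PS → ℂ) :
    ∑ τ : Triple e PH PS, w τ * fockInner (cubicVector e PH PS κ)
        (X τ.u * (X τ.a * (X τ.b * cubicVector e PH PS κ))) =
      (∑ τ : Triple e PH PS, w τ * conj (κ τ)) *
          ((∑ S : Finset (Triple e PH PS), ‖setCoeff κ (TripleAdm e) S‖ ^ 2 : ℝ) : ℂ) -
        ∑ τ : Triple e PH PS, w τ * conj (κ τ) *
          ((∑ S : Finset (Triple e PH PS), (if TripleAdm e S ∧ (τ ∈ S ∨ ¬ TripleAdm e (insert τ S)) then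
            ‖setCoeff κ (TripleAdm e) S‖ ^ 2 else 0) : ℝ) : ℂ) := by
  rw [Finset.sum_mul, ← Finset.sum_sub_distrib]
  refine Finset.sum_congr rfl fun τ _ => ?_
  rw [fockInner_cubicVector_X_mul_X_mul_X_mul hHS κ τ]
  have h := sum_ite_adm_mem_normSq_erase hHS κ τ
  have hc : (∑ S : Finset (Triple e PH PS), (if TripleAdm e S ∧ τ ∈ S then
      conj (setCoeff κ (TripleAdm e) (S.erase τ)) * setCoeff κ (TripleAdm e) (S.erase τ) else 0)) =
      ((∑ S : Finset (Triple e PH PS), (if TripleAdm e S ∧ τ ∈ S then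
        ‖setCoeff κ (TripleAdm e) (S.erase τ)‖ ^ 2 else 0) : ℝ) : ℂ) := by
    rw [Complex.ofReal_sum]
    refine Finset.sum_congr rfl fun S _ => ?_
    split_ifs
    · rw [Complex.conj_mul', Complex.ofReal_pow]
    · rw [Complex.ofReal_zero]
  rw [hc, h]
  push_cast
  ring

/-- **The norm as a coefficient sum** (real form of (normA)). [cite: BastiCenatiempoSchlein2021, (2.16)] -/
theorem fockInner_cubicVector_self_re [Fintype ι] (hHS : Disjoint PH PS) (κ : Triple e PH PS → ℂ) :
    (fockInner (cubicVector e PH PS κ) (cubicVector e PH PS κ)).re =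
      ∑ S : Finset (Triple e PH PS), ‖setCoeff κ (TripleAdm e) S‖ ^ 2 := by
  rw [fockInner_cubicVector_self hHS, Complex.re_sum]
  refine Finset.sum_congr rfl fun S _ => ?_
  rw [Complex.conj_mul', ← Complex.ofReal_pow, Complex.ofReal_re]

/-- **The cutoff error is a coincidence sum over admissible sets**: swapping the sums,
`∑_τ |w_τκ_τ| D_τ = ∑_{S : θ(S)} |c_S|² ∑_{τ : τ ∈ S ∨ ¬θ(S∪τ)} |w_τκ_τ|` — for fixed `S` the inner sum
runs over the triples in coincidence with `S` (the list (5.11) of [ibid.]), to be bounded by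
`|S|·sup F₁ + |S|(|S|-1)·sup F₂` and then by the hereditary bounds.
[cite: BastiCenatiempoSchlein2021, §5.2 (5.11), bounds `X₁`, `X₂`] -/
theorem sum_norm_mul_defect_eq [Fintype ι] (κ : Triple e PH PS → ℂ) (w : Triple e PH PS → ℂ) :
    ∑ τ : Triple e PH PS, ‖w τ * conj (κ τ)‖ *
        ∑ S : Finset (Triple e PH PS), (if TripleAdm e S ∧ (τ ∈ S ∨ ¬ TripleAdm e (insert τ S)) then
          ‖setCoeff κ (TripleAdm e) S‖ ^ 2 else 0) =
      ∑ S : Finset (Triple e PH PS), ‖setCoeff κ (TripleAdm e) S‖ ^ 2 *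
        ∑ τ : Triple e PH PS, (if TripleAdm e S ∧ (τ ∈ S ∨ ¬ TripleAdm e (insert τ S)) then
          ‖w τ * conj (κ τ)‖ else 0) := by
  simp only [Finset.mul_sum, mul_ite, mul_zero]
  rw [Finset.sum_comm]
  refine Finset.sum_congr rfl fun S _ => Finset.sum_congr rfl fun τ _ => ?_
  split_ifs
  · ring
  · rfl

end Freeing


/-! ## The quartic pairing structure (`⟨a_ya_xξ_ν, a_{y'}a_{x'}ξ_ν⟩` for hard modes): at most two
triples differ, and each differing triple is pinned to the annihilated modes -/

section QuarticStructure

variable [LinearOrder ι] {e : ι → Momentum} {PH PS : Finset ι}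

/-- **A triple whose three slots are occupied in an admissible set belongs to it** (the core of
unique pairing: the soft slot fixes `τⱼ`, the hard slots lie in `{uᵢ,aᵢ}`, `{uₖ,aₖ}`, the momentum
constraint is forbidden by `θ` unless `i = j = k`, and the orientation fixes the order).
[cite: BastiCenatiempoSchlein2021, after (2.15); §5.3 ("because of the cutoffs … at most two
indices can be involved in contractions with the observable")] -/
theorem TripleAdm.mem_of_slots_occupied (hHS : Disjoint PH PS) {S : Finset (Triple e PH PS)}
    (hS : TripleAdm e S) (τ' : Triple e PH PS)
    (hoU : setOcc Triple.u Triple.a Triple.b S τ'.u ≠ 0)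
    (hoA : setOcc Triple.u Triple.a Triple.b S τ'.a ≠ 0)
    (hoB : setOcc Triple.u Triple.a Triple.b S τ'.b ≠ 0) : τ' ∈ S := by
  obtain ⟨hu', ha', hb', hsum', hlt'⟩ := τ'.prop
  obtain ⟨τi, hi, hiu⟩ := exists_slot_of_setOcc_ne_zero hoU
  obtain ⟨τk, hk, hka⟩ := exists_slot_of_setOcc_ne_zero hoA
  obtain ⟨τj, hj, hjb⟩ := exists_slot_of_setOcc_ne_zero hoB
  have hpi := τi.prop; have hpk := τk.prop; have hpj := τj.prop
  have hjb' : τj.b = τ'.b := by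
    rcases hjb with h | h | h
    · exact absurd (h ▸ hpj.1) (Finset.disjoint_right.1 hHS hb')
    · exact absurd (h ▸ hpj.2.1) (Finset.disjoint_right.1 hHS hb')
    · exact h
  have hiu' : τ'.u ∈ ({τi.u, τi.a} : Finset ι) := by
    rcases hiu with h | h | h
    · simp [h]
    · simp [h]
    · exact absurd (h ▸ hpi.2.2.1) (Finset.disjoint_left.1 hHS hu')
  have hka' : τ'.a ∈ ({τk.u, τk.a} : Finset ι) := by
    rcases hka with h | h | h
    · simp [h]
    · simp [h]
    · exact absurd (h ▸ hpk.2.2.1) (Finset.disjoint_left.1 hHS ha')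
  have hjk : τj = τk := by
    by_contra hjk
    exact hS τi hi τj hj τk hk hjk τ'.u hiu' τ'.a hka' (by rw [hjb']; exact hsum')
  have hji : τj = τi := by
    by_contra hji
    refine hS τk hk τj hj τi hi hji τ'.a hka' τ'.u hiu' ?_
    rw [hjb', add_comm (e τ'.a)]; exact hsum'
  subst hjk; subst hji
  simp only [Finset.mem_insert, Finset.mem_singleton] at hiu' hka'
  have hlt := hpj.2.2.2.2
  rcases hiu' with h1 | h1 <;> rcases hka' with h2 | h2
  · exact absurd (h1.trans h2.symm) (ne_of_lt hlt')
  · rw [Triple.ext' h1 h2 hjb'.symm]; exact hj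
  · rw [h1, h2] at hlt'; exact absurd hlt (lt_asymm hlt')
  · exact absurd (h1.trans h2.symm) (ne_of_lt hlt')

/-- **Pinning**: if `θ(S')` and the occupation vectors agree after annihilating the hard modes
`x, y` from `S` and `x', y'` from `S'` (`d(S) + δ_{x'} + δ_{y'} = d(S') + δ_x + δ_y`, all four in
`P_H`), then every triple of `S` not in `S'` has a hard slot equal to `x` or `y`.
[cite: BastiCenatiempoSchlein2021, §5.3 (cases 1)–2))] -/
theorem TripleAdm.pinned_of_setOcc_eq (hHS : Disjoint PH PS) {S S' : Finset (Triple e PH PS)}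
    (hS' : TripleAdm e S') {x y x' y' : ι} (hx : x ∈ PH) (hy : y ∈ PH) (hx' : x' ∈ PH) (hy' : y' ∈ PH)
    (h : setOcc Triple.u Triple.a Triple.b S + (Finsupp.single x' 1 + Finsupp.single y' 1) =
      setOcc Triple.u Triple.a Triple.b S' + (Finsupp.single x 1 + Finsupp.single y 1))
    {τ : Triple e PH PS} (hτS : τ ∈ S) (hτS' : τ ∉ S') :
    τ.u = x ∨ τ.u = y ∨ τ.a = x ∨ τ.a = y := by
  have hτ := τ.prop
  obtain ⟨hoU, hoA, hoB⟩ := setOcc_slot_ne_zero hτS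
  -- pointwise form of the multiset equation
  have hpt : ∀ i, setOcc Triple.u Triple.a Triple.b S i + ((if x' = i then 1 else 0) + (if y' = i then 1 else 0)) =
      setOcc Triple.u Triple.a Triple.b S' i + ((if x = i then 1 else 0) + (if y = i then 1 else 0)) := by
    intro i
    have := congrArg (fun f => f i) h
    simpa [Finsupp.add_apply, Finsupp.single_apply] using this
  -- the soft slot of `τ` stays occupied in `S'`
  have hne : ∀ {z : ι}, z ∈ PH → z ≠ τ.b := fun hz hh => Finset.disjoint_left.1 hHS hz (hh ▸ hτ.2.2.1)
  have hb' : setOcc Triple.u Triple.a Triple.b S' τ.b ≠ 0 := by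
    have hb := hpt τ.b
    rw [if_neg (hne hx'), if_neg (hne hy'), if_neg (hne hx), if_neg (hne hy), add_zero, add_zero,
      add_zero] at hb
    rw [← hb]; exact hoB
  by_contra hno
  push Not at hno
  obtain ⟨h1, h2, h3, h4⟩ := hno
  have hu' : setOcc Triple.u Triple.a Triple.b S' τ.u ≠ 0 := by
    have hu := hpt τ.u
    rw [if_neg (Ne.symm h1), if_neg (Ne.symm h2), add_zero] at hu
    intro h0; rw [h0] at hu; omega
  have ha' : setOcc Triple.u Triple.a Triple.b S' τ.a ≠ 0 := by
    have ha := hpt τ.a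
    rw [if_neg (Ne.symm h3), if_neg (Ne.symm h4), add_zero] at ha
    intro h0; rw [h0] at ha; omega
  exact hτS' (hS'.mem_of_slots_occupied hHS τ hu' ha' hb')

/-- **At most two triples differ**: under the same hypotheses (and `θ(S)`), `|S ∖ S'| ≤ 2` — the
differing triples are pinned to `x`, `y` and distinct triples of `S` have distinct hard slots.
[cite: BastiCenatiempoSchlein2021, §5.3 ("at most two indices `i,j ∈ {1,…,m}` can be involved in
contractions with the observable")] -/
theorem TripleAdm.card_sdiff_le_two (hHS : Disjoint PH PS) {S S' : Finset (Triple e PH PS)}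
    (hS : TripleAdm e S) (hS' : TripleAdm e S') {x y x' y' : ι} (hx : x ∈ PH) (hy : y ∈ PH)
    (hx' : x' ∈ PH) (hy' : y' ∈ PH)
    (h : setOcc Triple.u Triple.a Triple.b S + (Finsupp.single x' 1 + Finsupp.single y' 1) =
      setOcc Triple.u Triple.a Triple.b S' + (Finsupp.single x 1 + Finsupp.single y 1)) :
    (S \ S').card ≤ 2 := by
  classical
  -- the pinning map into `{x, y}`
  have hpin : ∀ τ ∈ S \ S', ∃ p ∈ ({x, y} : Finset ι), p ∈ ({τ.u, τ.a} : Finset ι) := by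
    intro τ hτ
    rw [Finset.mem_sdiff] at hτ
    rcases hS'.pinned_of_setOcc_eq hHS hx hy hx' hy' h hτ.1 hτ.2 with h1 | h1 | h1 | h1
    · exact ⟨x, by simp, by simp [h1]⟩
    · exact ⟨y, by simp, by simp [h1]⟩
    · exact ⟨x, by simp, by simp [h1]⟩
    · exact ⟨y, by simp, by simp [h1]⟩
  haveI : Inhabited ι := ⟨x⟩
  choose! f hf hf' using hpin
  calc (S \ S').card ≤ ({x, y} : Finset ι).card := by
        refine Finset.card_le_card_of_injOn f (fun τ hτ => hf τ hτ) ?_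
        intro τ₁ h₁ τ₂ h₂ hfeq
        by_contra hne
        have h₁S : τ₁ ∈ S := (Finset.mem_sdiff.1 (Finset.mem_coe.1 h₁)).1
        have h₂S : τ₂ ∈ S := (Finset.mem_sdiff.1 (Finset.mem_coe.1 h₂)).1
        exact hS.hard_ne h₁S h₂S hne (hf' τ₁ (Finset.mem_coe.1 h₁)) (hfeq ▸ hf' τ₂ (Finset.mem_coe.1 h₂))
    _ ≤ 2 := Finset.card_le_two

end QuarticStructure

end Fock

end Literature.MathematicalPhysics.QuantumManyBody.BoseGas

end
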